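import Literature.MathematicalPhysics.QuantumFieldTheory.Federbush1986.ModeEstimatesPerRow
import Literature.MathematicalPhysics.QuantumFieldTheory.Federbush1986.ModeEstimatesSuperposition
import Literature.MathematicalPhysics.QuantumFieldTheory.Federbush1986.PlaquetteConsistencyLocal
import Literature.MathematicalPhysics.QuantumFieldTheory.Federbush1986.PlaquetteStokes
import Literature.MathematicalPhysics.QuantumFieldTheory.Federbush1986.SmoothGaugeInterpolation
import Literature.MathematicalPhysics.QuantumFieldTheory.Federbush1986.LatticeAxialPotential

/-!
# `Federbush1986.PhaseCellVPostscriptLemmaA1` — [Federbush1990PhaseCellV] Appendix A «A Postscript to I», **Lemma A.1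
# (Plaquette–Plaquette fall off Estimates) (A.1)–(A.3), p. 451**: the GENERAL-DATA form of Estimates 0.6–0.7 of
# [Federbush1986PhaseCellI] — PROVED for the concrete Bałaban averaging by the printed route (radial axial gauge about the
# nearest coarse vertex, edge assignments bounded by plaquette assignments (Lemma 5.5 of III), Estimates 0.6 and 0.7 of I)

statement-level skeleton of published theorems with citation tags; proofs where landed; nothing here is a claim about the Yang–Mills mass gap

CITATION HEADER.  P. Federbush, *A phase cell approach to Yang–Mills theory. V. Analysis of a chunk*, Commun. Math. Phys.
**127** (1990) 433–457 [Federbush1990PhaseCellV], Appendix A, p. 451.  HELD: lit store `paper:url-c5e0c3eb5105` (Euclid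
«1104180215.pdf», journal page = PDF page + 432; the displays (A.1)–(A.3) are lost in its text layer) and the cell's page scan
`run/shared/lean/pub/pub-balaban/t4/b2b-balaban-t4-lit2/pdf/fed1990-cmp127-V.pdf`, RENDERED AND READ AS AN IMAGE for this file:
`run/sessions/literature-prover-lit-balaban-r17-g22-0/folder/renders/fedV/fed1990-cmp127-V-p019-x2.png` (= p. 451).
THE PRINT, verbatim (p. 451): *«Appendix A. A Postscript to I.  In this Appendix we are in the set-up of I, studying the
plaquette assignments of a continuum field minimizing the continuum action, for the Abelian theory, with plaquette assignments
specified at length scale L, level r.  Lemma A.1. Plaquette–Plaquette fall off Estimates: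
|A_{∂p}| ≤ c (l/L)² Σ_{P∈𝒫^r} |A_{∂P}| e^{−γ′d(p,P)/L}.  (A.1)
Here p is at length scale l, the P at length scale L. γ′ is any number, γ′ < γ (γ as in I). Now let p₁ and p₂ be parallel
(oriented) plaquettes at length scale l,
|A_{∂p₁} − A_{∂p₂}| ≤ c_ε (d(p₁,p₂))^{1−ε} (l²/L^{3−ε}) Σ_{P∈𝒫^r} e^{−γ′d(p₁,P)/L} |A_{∂P}|  (A.2)
for each ε > 0, where d(p₁,p₂) is measured between corresponding vertices and  d(p₁,p₂) < cL.  (A.3)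
It may seem that these results should follow immediately from the estimates in I, but we require a small additional argument.
We find a vertex in the length scale L lattice, i.e. in 𝒱^r, that is closest to p in (A.1) or p₁ in (A.2). We now construct the
field, in the lattice ℒ^r, in a radial axial gauge radiating out from this vertex (using the universal radial tree). Of course
this does not change plaquette assignments. Edge assignments are easily bounded in terms of plaquette bounds, (using Lemma 5.5 of
III) bounds that, loosely speaking, grow as some power of distance in the radial direction. Using these bounds, and Estimates 0.6
and 0.7 of I, the lemma follows.»*

lit-balaban cell (HOME `run/shared/lean/pub/lit-balaban/`), reader/typer seat r17 gen 22 (fold owner of the Federbush block;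
TAKING line HOME/STATUS.md 2026-08-23T00:2xZ; proposed SKELETON row **F5.LemA.1**, the general-data form of rows F1.Eq0.9 and
F1.Eq0.10-0.11).  INPUT ROWS, BY NAME: F1.Eq0.9 / F1.Eq0.10-0.11 / F1.Eq3.1 (`CorrectedMode.modeEstimatesLe`, r17 g12 p327394;
`ModeEstimatesSuperposition.unit_of_modeEstimatesLe`, `superpose`, `plaq_superpose`, r17 g10), F1.Eq1.12-1.14
(`axialTreeAveraging_plaq_eq_plaqFunctional`), F1.Eq4.1-4.6 (`LatticeGauge.interp`, `bond_pureGauge`), F3.Lem5.5 (here in its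
explicit abelian form for the comb: §2), F6 Stokes infrastructure (`PlaquetteStokes.loop_eq_integral_curl`).

THE MATHEMATICS (level `0`, `L = ℓ₀ = 1`; print's «length scale L, level r» is recovered by the scaling of I §3, see §7).
Data: a finitely supported level-0 bond assignment `a` (support in a box), its plaquette assignments `F(P) = plaqOfBonds a P`.
The tree's constrained minimiser is the superposition `A = Σ_e a(e) N_e` of lattice translates of the four unit-configuration
modes (`ModeTranslation.isConstrainedMinimizer_superposition`), whose fine plaquette variables are
`A_{∂q} = Σ_e a(e) Π_e(q)` with `|Π_e(q)| ≤ c ℓ_s² e^{−γ d(q, e)}` (Estimate 0.6 of the unit modes).  (i) GAUGE INVARIANCE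
(«Of course this does not change plaquette assignments»): for every finitely supported lattice gauge function `λ` the
superposition minimiser of the pure-gauge data `dλ` has a zero-action competitor `d(interp λ)`, hence zero action, hence is flat,
hence all its plaquette variables vanish (Green's identity); by linearity `Σ_e a(e)Π_e(q) = Σ_e (a − dλ)(e) Π_e(q)`.
(ii) THE RADIAL AXIAL GAUGE about the coarse vertex `v` nearest `q` («using the universal radial tree»; here the two-sided
comb about `v`, whose paths are coordinate-monotone): the comb path sum `λ = combPot a v` satisfies the EXPLICIT ABELIAN FORM OF
LEMMA 5.5 OF III: `a(x, μ) − (λ(x + e_μ) − λ(x))` = a signed sum of the plaquette assignments `F` over at most `‖x − v‖₁`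
plaquettes, each with base `z` satisfying `|z_j − v_j| ≤ |x_j − v_j|` — so `d(q, P) ≤ d(q, (x, μ)) + 4` for every plaquette
used («edge assignments are easily bounded in terms of plaquette bounds»).  (iii) `λ` is truncated to the cube
`‖x − v‖_∞ ≤ R` so that `dλ_R` is finitely supported; the boundary bonds carry `|dλ_R| ≤ 4R·max|a|` at distance `≥ R − 2`
from `q`, a contribution `O(R⁵ e^{−γR}) → 0`.  (iv) Exchanging the sums, with `e^{−γd(q,e)} ≤ e^{4γ′}e^{−γ′d(q,P)}e^{−(γ−γ′)d(q,e)}`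
and the lattice sum `Σ_e e^{−(γ−γ′)d(q,e)} ≤ 4e^{2(γ−γ′)} Z((γ−γ′)/4)⁴`, `Z(δ) = Σ_{m∈ℤ} e^{−δ|m|}`:
`|A_{∂q}| ≤ c ℓ_s² · K(γ, γ′) · Σ_P |F(P)| e^{−γ′ d(q, P)}` for EVERY `γ′ < γ` — (A.1).  (A.2) is the same argument with
`Π_e(q₁) − Π_e(q₂)` and Estimate 0.7 of the unit modes.

WHAT IS PROVED (namespace `PostscriptV`).  §1 `ssum`/`asum` (two-sided discrete line integrals; `ssum_succ`, `ssum_sub_succ`);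
§2 the comb about `v`: `segPt`, `combPot`, `combFix`, `fluxSum`, **`combFix_eq_fluxSum`** (Lemma 5.5 of III in the comb gauge,
explicit abelian form: the gauge-fixed bond variable IS the signed flux of the plaquette variables through the ladder of
plaquettes swept by the comb path), `abs_combFix_le`; §3 geometry: `abs_segPt_sub_le`/`dist_plaq_le` (swept plaquettes lie
coordinatewise between `v` and the bond), `fluxAbs_le`, the cube cut-off `cutPot` with `sub_lgrad_cutPot_of_in`,
`abs_lgrad_cutPot_le`, `inCube_succ_of_lgrad_ne_zero`, `exists_ge_of_not_in`, `dist_ge_of_exists_ge`; §4 lattice sums `Z1`,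
`sum_exp_le` (product trick), `weighted_sum_le`; §5 `plaqBox`, `phiSum` (print's right-hand side); §6 **`plaq_superpose_lgrad`**
(the superposition minimiser of pure-gauge data is flat: zero-action competitor `d(interp λ)`, `fieldStrength_eq_zero_of_contAction_eq_zero`,
Green's identity `PlaquetteStokes.loop_eq_integral_curl`, (1.14) `axialTreeAveraging_plaq_eq_plaqFunctional`), `kernel`,
**`sum_kernel_gauge`** (gauge invariance of `A_{∂q} = Σ_e a(e)Π_e(q)`); §7 **`pairing_bound`** (the core estimate: comb gauge about
`v`, truncation at radius `R`, flux bound, lattice sum, `R → ∞` via `tendsto_tail`); §8 `nearPt`/`dist_nearPt_le`, `constA1`,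
**`lemmaA1_level0`** ((A.1) and (A.2)–(A.3) at level `0`, `L = 1`, from Estimates 0.6/0.7 of the unit modes of
`CorrectedMode.modeEstimatesLe`); §9 `atLevel`, `scale_factor`, **`lemmaA1`** = LEMMA A.1 AS PRINTED (data at level `r`,
`L = ℓ_r`; `p ∈ 𝒫^s`, `s ≥ r`, `l = ℓ_s`; factors `(l/L)²`, `l²/L^{3−ε}`, weights `e^{−γ′d(p,P)/L}`, region `d(p₁,p₂) < cL`) by the
scaling of I §3 (`isConstrainedMinimizer_iff_scaleField`, `plaq_unscaleField_level`).

HONEST SCOPE.  (a) Concrete averaging `axialTreeAveraging` and the `≤` readings (as every proved Federbush-I row).  (b) «γ as in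
I»: the rate `γ` of Estimates 0.6/0.7 of the unit-configuration modes delivered by `CorrectedMode.modeEstimatesLe`; the
theorem quantifies `∃ γ > 0, ∀ γ′ ∈ (0, γ), c(γ′) > 0` exactly as printed («γ′ is any number, γ′ < γ»), the constant depending on
`γ′` (`constA1 c γ γ′ = c·e^{4γ′}·C₁((γ−γ′)/2)`); the (A.2) constant is `constA1 |c_ε| γ γ′` with `c_ε` that of Estimate 0.7.
(c) «radial axial gauge … universal radial tree»: print's radial maximal tree (III §5.4 B) is replaced by the two-sided comb about
`v` — also a maximal tree radiating from `v`, with coordinate-monotone paths, which is the property the argument uses (swept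
plaquettes no farther from `v` than the bond: NO loss in the rate); the «power of distance» growth is `‖x − v‖₁` plaquettes per
bond.  (d) Data finitely supported in a box (print's `Σ_{P∈𝒫^r}` is then the finite sum over `plaqBox (M+1)`, all other
plaquette variables being `0`; I's data are finitely supported).  (e) (A.3): the region constant is the constant `c` of Estimate
0.7 of I (print's generic `c`).  (f) `A` is THE tree's minimiser (superposition of unit modes, rescaled); print speaks of «a
continuum field minimizing the continuum action» — minimisers are not unique ([Federbush1986PhaseCellI] p. 320), the statement is
existential as in every Federbush-I row.  Definitions with bodies (`ssum`, `asum`, `segPt`, `combPot`, `combFix`, `fluxSum`,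
`fluxAbs`, `InCube`, `cubeSet`, `cutPot`, `lgrad`, `Z1`, `C1`, `plaqOfTriple`, `plaqBox`, `phiSum`, `kernel`, `supNorm`, `nearPt`,
`constA1`, `atLevel`), everything else theorems; no `Prop`-valued definition, no new named fact; axioms standard
(`lemmaA1`: propext, Classical.choice, Quot.sound).  Unit `lit-balaban-r17` gen 22.
-/

namespace Literature.MathematicalPhysics.QuantumFieldTheory.Federbush1986

noncomputable section

open MeasureTheory Filter Set
open scoped Topology BigOperators ContDiff

namespace PostscriptV

open LatticePotential (vtx vtx_zero vtx_four vtx_succ vtx_add_single_of_le vtx_add_single_of_lt)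

/-! ## §1  Signed interval sums along a lattice axis (two-sided discrete line integrals) -/

/-- The signed sum `Σ_{t=i}^{j−1} f(t)` (`= −Σ_{t=j}^{i−1} f(t)` when `j < i`): the discrete line integral from `i` to `j`.
[cite: Federbush1987PhaseCellIII, (5.11) p. 300; Federbush1986PhaseCellI, §1 p. 321] -/
def ssum (f : ℤ → ℝ) (i j : ℤ) : ℝ :=
  (∑ t ∈ Finset.range (j - i).toNat, f (i + t)) - ∑ t ∈ Finset.range (i - j).toNat, f (j + t)

/-- The sum of `|f|` over the same integers. [cite: Federbush1987PhaseCellIII, (5.12) p. 301] -/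
def asum (f : ℤ → ℝ) (i j : ℤ) : ℝ :=
  (∑ t ∈ Finset.range (j - i).toNat, |f (i + t)|) + ∑ t ∈ Finset.range (i - j).toNat, |f (j + t)|

/-- `ssum f i i = 0`. [cite: Federbush1987PhaseCellIII, (5.11) p. 300] -/
theorem ssum_self (f : ℤ → ℝ) (i : ℤ) : ssum f i i = 0 := by
  simp [ssum]

/-- The defining recursion: extending the upper end by one adds `f j` (both orientations). [cite: Federbush1987PhaseCellIII,
(5.11) p. 300] -/
theorem ssum_succ (f : ℤ → ℝ) (i j : ℤ) : ssum f i (j + 1) = ssum f i j + f j := by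
  unfold ssum
  rcases le_or_gt i j with h | h
  · have h1 : (j + 1 - i).toNat = (j - i).toNat + 1 := by omega
    have h2 : (i - (j + 1)).toNat = 0 := by omega
    have h3 : (i - j).toNat = 0 := by omega
    have h4 : i + ((j - i).toNat : ℕ) = j := by omega
    rw [h1, h2, h3, Finset.sum_range_succ, Finset.sum_range_zero, h4]
    ring
  · have h1 : (j + 1 - i).toNat = 0 := by omega
    have h2 : (j - i).toNat = 0 := by omega
    have h3 : (i - j).toNat = (i - (j + 1)).toNat + 1 := by omega
    rw [h1, h2, h3, Finset.sum_range_zero, Finset.sum_range_succ']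
    have h4 : ∀ t : ℕ, j + ((t + 1 : ℕ) : ℤ) = j + 1 + (t : ℤ) := fun t => by push_cast; ring
    simp_rw [h4]
    simp only [Nat.cast_zero, add_zero]
    ring

/-- `|ssum f i j| ≤ asum f i j`. [cite: Federbush1987PhaseCellIII, (5.12) p. 301] -/
theorem abs_ssum_le (f : ℤ → ℝ) (i j : ℤ) : |ssum f i j| ≤ asum f i j := by
  unfold ssum asum
  exact (abs_sub _ _).trans (add_le_add (Finset.abs_sum_le_sum_abs _ _) (Finset.abs_sum_le_sum_abs _ _))

/-- `asum ≥ 0`. [folklore] -/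
private theorem asum_nonneg (f : ℤ → ℝ) (i j : ℤ) : 0 ≤ asum f i j :=
  add_nonneg (Finset.sum_nonneg fun _ _ => abs_nonneg _) (Finset.sum_nonneg fun _ _ => abs_nonneg _)

/-- Linearity: `ssum (f − g) = ssum f − ssum g`. [folklore] -/
private theorem ssum_sub (f g : ℤ → ℝ) (i j : ℤ) : ssum (fun t => f t - g t) i j = ssum f i j - ssum g i j := by
  simp only [ssum, Finset.sum_sub_distrib]
  ring

/-- Telescoping: the signed sum of the forward differences of `g` from `i` to `j` is `g j − g i`, whichever way `j` lies.
[cite: Federbush1987PhaseCellIII, (5.11) p. 300] -/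
theorem ssum_sub_succ (g : ℤ → ℝ) (i j : ℤ) : ssum (fun t => g (t + 1) - g t) i j = g j - g i := by
  -- write `j = i + d` and induct on `d ∈ ℤ` in both directions
  obtain ⟨d, rfl⟩ : ∃ d, j = i + d := ⟨j - i, by ring⟩
  refine Int.induction_on d ?_ (fun n ih => ?_) (fun n ih => ?_)
  · rw [add_zero, ssum_self, sub_self]
  · rw [show i + ((n : ℤ) + 1) = i + n + 1 by ring, ssum_succ, ih]
    ring
  · have h := ssum_succ (fun t => g (t + 1) - g t) i (i + (-(n : ℤ) - 1))
    rw [show i + (-(n : ℤ) - 1) + 1 = i + -(n : ℤ) by ring, ih] at h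
    linarith

/-! ## §2  The two-sided comb («radial axial gauge radiating out from this vertex») and the explicit abelian form of
Lemma 5.5 of III: bond variables in the comb gauge are signed sums of plaquette variables -/

/-- The lattice point of the `k`-th segment of the comb path from `v` to `x` whose `k`-th coordinate is `t` (coordinates `< k`
those of `x`, `> k` those of `v`). [cite: Federbush1990PhaseCellV, App. A p. 451 («radial axial gauge radiating out from this
vertex»); Federbush1987PhaseCellIII, §5.4 B) p. 307] -/
def segPt (v x : Fin 4 → ℤ) (k : Fin 4) (t : ℤ) : Fin 4 → ℤ := vtx v x k + Pi.single k (t - v k)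

/-- **The comb path sum** (the lattice gauge function of the radial axial gauge about `v`): the signed sum of the bond function
along the comb path from `v` to `x` (axis `0` first, then `1`, `2`, `3`; each segment in either orientation).
[cite: Federbush1990PhaseCellV, App. A p. 451; Federbush1986PhaseCellI, §1 p. 321] -/
def combPot (a : Edge 0 → ℝ) (v x : Fin 4 → ℤ) : ℝ :=
  ∑ k : Fin 4, ssum (fun t => a ⟨segPt v x k t, k⟩) (v k) (x k)

/-- The bond function in the comb gauge about `v`: `a(x, μ) − (λ(x + e_μ) − λ(x))`, `λ = combPot a v`.
[cite: Federbush1990PhaseCellV, App. A p. 451; Federbush1987PhaseCellIII, §5.3 2) p. 303] -/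
def combFix (a : Edge 0 → ℝ) (v : Fin 4 → ℤ) (e : Edge 0) : ℝ :=
  a e - (combPot a v (e.base + Pi.single e.dir 1) - combPot a v e.base)

/-- **The flux sum**: the signed sum of the plaquette variables over the plaquettes swept when the comb path to `x` is pushed
by `e_μ` — the plaquettes `(segPt v x k t; k, μ)`, `k > μ`, `t` between `v_k` and `x_k`. [cite: Federbush1987PhaseCellIII,
Lemma 5.5 (5.11)–(5.12) p. 300–301; Federbush1990PhaseCellV, App. A p. 451] -/
def fluxSum (a : Edge 0 → ℝ) (v x : Fin 4 → ℤ) (μ : Fin 4) : ℝ :=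
  ∑ k : Fin 4, if μ < k then ssum (fun t => plaqOfBonds a ⟨segPt v x k t, k, μ⟩) (v k) (x k) else 0

/-- The absolute flux: `Σ_{k>μ} Σ_t |F(segPt v x k t; k, μ)|`. [cite: Federbush1987PhaseCellIII, (5.12) p. 301] -/
def fluxAbs (a : Edge 0 → ℝ) (v x : Fin 4 → ℤ) (μ : Fin 4) : ℝ :=
  ∑ k : Fin 4, if μ < k then asum (fun t => plaqOfBonds a ⟨segPt v x k t, k, μ⟩) (v k) (x k) else 0

variable {a : Edge 0 → ℝ} {v x : Fin 4 → ℤ}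

/-- The `k`-th coordinate of `vtx v x k` is still `v k`. [folklore] -/
private theorem vtx_apply_self (v x : Fin 4 → ℤ) (k : Fin 4) : vtx v x k k = v k := by
  simp [vtx]

/-- `segPt v x k (v k) = vtx v x k` (start of the segment). [folklore] -/
private theorem segPt_start (v x : Fin 4 → ℤ) (k : Fin 4) : segPt v x k (v k) = vtx v x k := by
  simp [segPt]

/-- `segPt v x k (x k) = vtx v x (k+1)` (end of the segment). [folklore] -/
private theorem segPt_end (v x : Fin 4 → ℤ) (k : Fin 4) : segPt v x k (x k) = vtx v x ((k : ℕ) + 1) := by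
  rw [segPt, vtx_succ]

/-- Advancing along the segment: `segPt v x k (t + 1) = segPt v x k t + e_k`. [folklore] -/
private theorem segPt_succ (v x : Fin 4 → ℤ) (k : Fin 4) (t : ℤ) :
    segPt v x k (t + 1) = segPt v x k t + Pi.single k 1 := by
  simp only [segPt, add_assoc, ← Pi.single_add]
  congr 2
  ring

/-- Segments BEFORE the pushed direction are unchanged. [cite: Federbush1987PhaseCellIII, §5.3 p. 303] -/
theorem segPt_add_single_of_lt {k μ : Fin 4} (h : (k : ℕ) < μ) (t : ℤ) :
    segPt v (x + Pi.single μ 1) k t = segPt v x k t := by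
  rw [segPt, segPt, vtx_add_single_of_le v x h.le]

/-- The segment IN the pushed direction is unchanged as a line (it only gets longer). [cite: Federbush1987PhaseCellIII, §5.3 p. 303] -/
theorem segPt_add_single_self (μ : Fin 4) (t : ℤ) : segPt v (x + Pi.single μ 1) μ t = segPt v x μ t := by
  rw [segPt, segPt, vtx_add_single_of_le v x le_rfl]

/-- Segments AFTER the pushed direction are translated by `e_μ`. [cite: Federbush1987PhaseCellIII, §5.3 p. 303] -/
theorem segPt_add_single_of_gt {k μ : Fin 4} (h : (μ : ℕ) < k) (t : ℤ) :
    segPt v (x + Pi.single μ 1) k t = segPt v x k t + Pi.single μ 1 := by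
  rw [segPt, segPt, vtx_add_single_of_lt v x h]
  abel

/-- Term `k < μ` of `combPot`: unchanged. [cite: Federbush1987PhaseCellIII, §5.3 p. 303] -/
theorem term_lt {k μ : Fin 4} (h : (k : ℕ) < μ) :
    ssum (fun t => a ⟨segPt v (x + Pi.single μ 1) k t, k⟩) (v k) ((x + Pi.single μ 1 : Fin 4 → ℤ) k)
      = ssum (fun t => a ⟨segPt v x k t, k⟩) (v k) (x k) := by
  have hkμ : k ≠ μ := fun e => by subst e; omega
  simp only [segPt_add_single_of_lt h, Pi.add_apply, Pi.single_eq_of_ne hkμ, add_zero]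

/-- Term `k = μ` of `combPot`: gains the bond `(vtx v x (μ+1), μ)`. [cite: Federbush1987PhaseCellIII, §5.3 p. 303] -/
theorem term_eq (μ : Fin 4) :
    ssum (fun t => a ⟨segPt v (x + Pi.single μ 1) μ t, μ⟩) (v μ) ((x + Pi.single μ 1 : Fin 4 → ℤ) μ)
      = ssum (fun t => a ⟨segPt v x μ t, μ⟩) (v μ) (x μ) + a ⟨vtx v x ((μ : ℕ) + 1), μ⟩ := by
  simp only [segPt_add_single_self, Pi.add_apply, Pi.single_eq_same]
  rw [ssum_succ, segPt_end]

/-- Term `k > μ` of `combPot`: the translated segment sum differs from the original by the boundary bonds in direction `μ`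
MINUS the flux through the plaquettes between them (the abelian Stokes identity on a ladder of plaquettes).
[cite: Federbush1987PhaseCellIII, Lemma 5.4 (5.7)–(5.10) p. 300, Lemma 5.5 (5.11) p. 300; Federbush1986PhaseCellI, (1.4) p. 322] -/
theorem term_gt {k μ : Fin 4} (h : (μ : ℕ) < k) :
    ssum (fun t => a ⟨segPt v (x + Pi.single μ 1) k t, k⟩) (v k) ((x + Pi.single μ 1 : Fin 4 → ℤ) k)
      = ssum (fun t => a ⟨segPt v x k t, k⟩) (v k) (x k)
        + (a ⟨vtx v x ((k : ℕ) + 1), μ⟩ - a ⟨vtx v x k, μ⟩)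
        - ssum (fun t => plaqOfBonds a ⟨segPt v x k t, k, μ⟩) (v k) (x k) := by
  have hkμ : k ≠ μ := fun e => by subst e; omega
  simp only [segPt_add_single_of_gt h, Pi.add_apply, Pi.single_eq_of_ne hkμ, add_zero]
  -- the plaquette identity along the segment
  have hsq : ∀ t : ℤ, a ⟨segPt v x k t + Pi.single μ 1, k⟩
      = a ⟨segPt v x k t, k⟩ + ((a ⟨segPt v x k (t + 1), μ⟩ - a ⟨segPt v x k t, μ⟩)
          - plaqOfBonds a ⟨segPt v x k t, k, μ⟩) := by
    intro t
    simp only [plaqOfBonds, segPt_succ]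
    ring
  simp_rw [hsq]
  have e1 : (fun t => a ⟨segPt v x k t, k⟩ + ((a ⟨segPt v x k (t + 1), μ⟩ - a ⟨segPt v x k t, μ⟩)
      - plaqOfBonds a ⟨segPt v x k t, k, μ⟩))
      = fun t => a ⟨segPt v x k t, k⟩ - (plaqOfBonds a ⟨segPt v x k t, k, μ⟩
          - (a ⟨segPt v x k (t + 1), μ⟩ - a ⟨segPt v x k t, μ⟩)) := by
    funext t; ring
  rw [e1, ssum_sub, ssum_sub, ssum_sub_succ (fun t => a ⟨segPt v x k t, μ⟩), segPt_end, segPt_start]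
  ring

/-- **LEMMA 5.5 OF III IN THE COMB GAUGE, EXPLICIT ABELIAN FORM.**  For every level-0 bond function `a`, every centre `v` and
every bond `(x, μ)`: the comb-gauge bond variable `a(x, μ) − (λ(x+e_μ) − λ(x))` equals the flux sum of the plaquette variables
of `a` over the plaquettes `(segPt v x k t; k, μ)`, `k > μ`, `t` from `v_k` to `x_k` — «Edge assignments are easily bounded in
terms of plaquette bounds, (using Lemma 5.5 of III)». [cite: Federbush1990PhaseCellV, App. A p. 451; Federbush1987PhaseCellIII,
Lemma 5.5 (5.11)–(5.12) p. 300–301, §5.3 2) Observation p. 303] -/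
theorem combFix_eq_fluxSum (a : Edge 0 → ℝ) (v x : Fin 4 → ℤ) (μ : Fin 4) :
    combFix a v ⟨x, μ⟩ = fluxSum a v x μ := by
  have hx4 : vtx v x 4 = x := vtx_four v x
  have L := fun (k : Fin 4) (h : (k : ℕ) < μ) => term_lt (a := a) (v := v) (x := x) h
  have E := term_eq (a := a) (v := v) (x := x) μ
  have G := fun (k : Fin 4) (h : (μ : ℕ) < k) => term_gt (a := a) (v := v) (x := x) h
  unfold combFix combPot fluxSum
  simp only [Fin.sum_univ_four]
  fin_cases μ
  · have e := E
    have g1 := G 1 (by decide); have g2 := G 2 (by decide); have g3 := G 3 (by decide)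
    simp only [Fin.zero_eta, Fin.isValue, Fin.coe_ofNat_eq_mod, Nat.reduceMod, Nat.reduceAdd, hx4] at e g1 g2 g3 ⊢
    simp only [show ¬ ((0 : Fin 4) < 0) from by decide, show (0 : Fin 4) < 1 from by decide,
      show (0 : Fin 4) < 2 from by decide, show (0 : Fin 4) < 3 from by decide, if_true, if_false]
    linarith
  · have l0 := L 0 (by decide); have e := E
    have g2 := G 2 (by decide); have g3 := G 3 (by decide)
    simp only [Fin.mk_one, Fin.isValue, Fin.coe_ofNat_eq_mod, Nat.reduceMod, Nat.reduceAdd, hx4] at l0 e g2 g3 ⊢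
    simp only [show ¬ ((1 : Fin 4) < 0) from by decide, show ¬ ((1 : Fin 4) < 1) from by decide,
      show (1 : Fin 4) < 2 from by decide, show (1 : Fin 4) < 3 from by decide, if_true, if_false]
    linarith
  · have l0 := L 0 (by decide); have l1 := L 1 (by decide); have e := E
    have g3 := G 3 (by decide)
    simp only [Fin.reduceFinMk, Fin.isValue, Fin.coe_ofNat_eq_mod, Nat.reduceMod, Nat.reduceAdd, hx4] at l0 l1 e g3 ⊢
    simp only [show ¬ ((2 : Fin 4) < 0) from by decide, show ¬ ((2 : Fin 4) < 1) from by decide,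
      show ¬ ((2 : Fin 4) < 2) from by decide, show (2 : Fin 4) < 3 from by decide, if_true, if_false]
    linarith
  · have l0 := L 0 (by decide); have l1 := L 1 (by decide); have l2 := L 2 (by decide); have e := E
    simp only [Fin.reduceFinMk, Fin.isValue, Nat.reduceAdd, hx4] at l0 l1 l2 e ⊢
    simp only [show ¬ ((3 : Fin 4) < 0) from by decide, show ¬ ((3 : Fin 4) < 1) from by decide,
      show ¬ ((3 : Fin 4) < 2) from by decide, show ¬ ((3 : Fin 4) < 3) from by decide, if_false]
    linarith

/-- **The comb-gauge bond variables are bounded by the plaquette variables**: `|a(x,μ) − dλ(x,μ)| ≤ Σ_{k>μ} Σ_t |F(segPt; k, μ)|`.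
[cite: Federbush1990PhaseCellV, App. A p. 451; Federbush1987PhaseCellIII, Lemma 5.5 (5.12) p. 301] -/
theorem abs_combFix_le (a : Edge 0 → ℝ) (v x : Fin 4 → ℤ) (μ : Fin 4) : |combFix a v ⟨x, μ⟩| ≤ fluxAbs a v x μ := by
  rw [combFix_eq_fluxSum]
  unfold fluxSum fluxAbs
  refine (Finset.abs_sum_le_sum_abs _ _).trans (Finset.sum_le_sum fun k _ => ?_)
  split_ifs
  · exact abs_ssum_le _ _ _
  · simp


/-! ## §3  Geometry of the comb: where the flux plaquettes lie («grow as some power of distance in the radial direction»),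
the cube cut-off of the gauge function, and the bonds across the cut -/

open LatticeGauge (latPt latPt_sub norm_src_mono abs_cast_le_norm_src)

/-- `asum` is at most (number of terms) × (uniform bound): `asum f i j ≤ |j − i|·B` when `|f t| ≤ B` on the swept integers.
[cite: Federbush1987PhaseCellIII, (5.12) p. 301] -/
theorem asum_le_mul {f : ℤ → ℝ} {i j : ℤ} {B : ℝ}
    (h : ∀ t : ℤ, |t - i| ≤ |j - i| → |f t| ≤ B) : asum f i j ≤ |((j : ℝ) - i)| * B := by
  unfold asum
  have h1 : ∑ t ∈ Finset.range (j - i).toNat, |f (i + t)| ≤ (j - i).toNat * B := by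
    have := Finset.sum_le_card_nsmul (Finset.range (j - i).toNat) (fun t : ℕ => |f (i + t)|) B fun t ht => by
      refine h _ ?_
      have ht' := Finset.mem_range.1 ht
      rw [add_sub_cancel_left, abs_le]
      rcases abs_cases (j - i) with ⟨hji, _⟩ | ⟨hji, _⟩ <;> rw [hji] <;> constructor <;> omega
    simpa [Finset.card_range, nsmul_eq_mul] using this
  have h2 : ∑ t ∈ Finset.range (i - j).toNat, |f (j + t)| ≤ (i - j).toNat * B := by
    have := Finset.sum_le_card_nsmul (Finset.range (i - j).toNat) (fun t : ℕ => |f (j + t)|) B fun t ht => by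
      refine h _ ?_
      have ht' := Finset.mem_range.1 ht
      rw [abs_le]
      rcases abs_cases (j - i) with ⟨hji, _⟩ | ⟨hji, _⟩ <;> rw [hji] <;> constructor <;> omega
    simpa [Finset.card_range, nsmul_eq_mul] using this
  have h3 : ((j - i).toNat : ℝ) + ((i - j).toNat : ℝ) = |((j : ℝ) - i)| := by
    have hz : (((j - i).toNat : ℤ) + ((i - j).toNat : ℤ) : ℤ) = |j - i| := by
      rcases abs_cases (j - i) with ⟨hji, _⟩ | ⟨hji, _⟩ <;> rw [hji] <;> omega
    have := congrArg (fun z : ℤ => (z : ℝ)) hz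
    push_cast at this
    exact this
  calc _ ≤ (j - i).toNat * B + (i - j).toNat * B := add_le_add h1 h2
    _ = |((j : ℝ) - i)| * B := by rw [← add_mul, h3]

/-- `|x_k − v_k| ≤ ‖x − v‖` coordinatewise (lattice points of `ℤ⁴ ⊂ ℝ⁴`). [folklore] -/
private theorem abs_sub_le_dist (x v : Fin 4 → ℤ) (k : Fin 4) : |((x k : ℝ) - v k)| ≤ dist (latPt x) (latPt v) := by
  rw [dist_eq_norm, latPt_sub]
  have h := abs_cast_le_norm_src (x - v) 0 k
  simpa using h

/-- `Σ_k |x_k − v_k| ≤ 4‖x − v‖`. [folklore] -/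
private theorem sum_abs_sub_le_dist (x v : Fin 4 → ℤ) : ∑ k : Fin 4, |((x k : ℝ) - v k)| ≤ 4 * dist (latPt x) (latPt v) := by
  calc ∑ k : Fin 4, |((x k : ℝ) - v k)| ≤ ∑ _k : Fin 4, dist (latPt x) (latPt v) :=
        Finset.sum_le_sum fun k _ => abs_sub_le_dist x v k
    _ = 4 * dist (latPt x) (latPt v) := by simp

/-- **The comb path sum is bounded by (path length) × max|a|**: `|combPot a v z| ≤ (Σ_k |z_k − v_k|)·Am`.
[cite: Federbush1986PhaseCellI, §1 p. 321; Federbush1990PhaseCellV, App. A p. 451] -/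
theorem abs_combPot_le {Am : ℝ} (hAm : ∀ e : Edge 0, |a e| ≤ Am) (v z : Fin 4 → ℤ) :
    |combPot a v z| ≤ (∑ k : Fin 4, |((z k : ℝ) - v k)|) * Am := by
  unfold combPot
  rw [Finset.sum_mul]
  refine (Finset.abs_sum_le_sum_abs _ _).trans (Finset.sum_le_sum fun k _ => ?_)
  exact (abs_ssum_le _ _ _).trans (asum_le_mul fun t _ => hAm _)

/-- **LOCATION OF THE FLUX PLAQUETTES**: a plaquette `(segPt v x k t; k, μ)` swept by the comb path to `x` (so `|t − v_k| ≤
|x_k − v_k|`) lies coordinatewise between `v` and `x`: `|z_j − v_j| ≤ |x_j − v_j|` for all `j` — whence no farther from `v` than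
`x` is. [cite: Federbush1990PhaseCellV, App. A p. 451 («in the radial direction»); Federbush1987PhaseCellIII, §5.4 B) RP2 p. 307] -/
theorem abs_segPt_sub_le {k : Fin 4} {t : ℤ} (ht : |t - v k| ≤ |x k - v k|) (j : Fin 4) :
    |segPt v x k t j - v j| ≤ |x j - v j| := by
  unfold segPt
  simp only [Pi.add_apply, vtx, LatticePotential.vtx]
  by_cases hjk : j = k
  · subst hjk
    simp only [lt_irrefl, if_false, Pi.single_eq_same]
    rwa [add_sub_cancel_left]
  · rw [Pi.single_eq_of_ne hjk, add_zero]
    split_ifs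
    · exact le_rfl
    · simp

/-- Hence `d(segPt, v) ≤ d(x, v)`. [cite: Federbush1990PhaseCellV, App. A p. 451] -/
theorem dist_segPt_le {k : Fin 4} {t : ℤ} (ht : |t - v k| ≤ |x k - v k|) :
    dist (latPt (segPt v x k t)) (latPt v) ≤ dist (latPt x) (latPt v) := by
  rw [dist_eq_norm, dist_eq_norm, latPt_sub, latPt_sub]
  refine norm_src_mono (fun j => ?_) 0 0
  have h := abs_segPt_sub_le (v := v) (x := x) ht j
  have h' : |((segPt v x k t j - v j : ℤ) : ℝ)| ≤ |((x j - v j : ℤ) : ℝ)| := by exact_mod_cast h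
  simpa using h'

/-- **The plaquettes used for the bond `(x, μ)` are within `d(y, x) + 4` of any point `y` within `2` of `v`** — the geometric
input that keeps the rate: `e^{−γd(y,x)} ≤ e^{4γ′}e^{−γ′d(y,P)}e^{−(γ−γ′)d(y,x)}`. [cite: Federbush1990PhaseCellV, App. A p. 451] -/
theorem dist_plaq_le {y : E4} (hyv : dist y (latPt v) ≤ 2) {k μ : Fin 4} {t : ℤ} (ht : |t - v k| ≤ |x k - v k|) :
    dist y (⟨segPt v x k t, k, μ⟩ : Plaq 0).src ≤ dist y (latPt x) + 4 := by
  rw [ModeEstimatesScaling.plaqSrc_eq_edgeSrc 0 (segPt v x k t) k μ]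
  have h1 := dist_segPt_le (v := v) (x := x) (k := k) ht
  have h2 := dist_triangle y (latPt v) (latPt (segPt v x k t))
  have h3 := dist_triangle (latPt x) y (latPt v)
  rw [dist_comm (latPt v)] at h2
  rw [dist_comm (latPt x) y] at h3
  change dist y (latPt (segPt v x k t)) ≤ _
  linarith

/-- **THE FLUX BOUND**: if every plaquette swept for the bond `(x, μ)` has `|F| ≤ B`, then `fluxAbs ≤ (Σ_k |x_k − v_k|)·B`
(at most `‖x − v‖₁` plaquettes). [cite: Federbush1990PhaseCellV, App. A p. 451 («grow as some power of distance»);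
Federbush1987PhaseCellIII, (5.12) p. 301] -/
theorem fluxAbs_le {μ : Fin 4} {B : ℝ} (hB : 0 ≤ B)
    (h : ∀ (k : Fin 4) (t : ℤ), μ < k → |t - v k| ≤ |x k - v k| → |plaqOfBonds a ⟨segPt v x k t, k, μ⟩| ≤ B) :
    fluxAbs a v x μ ≤ (∑ k : Fin 4, |((x k : ℝ) - v k)|) * B := by
  unfold fluxAbs
  rw [Finset.sum_mul]
  refine Finset.sum_le_sum fun k _ => ?_
  split_ifs with hk
  · exact asum_le_mul fun t ht => h k t hk ht
  · exact mul_nonneg (abs_nonneg _) hB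

/-- The cube `‖x − v‖_∞ ≤ R` about `v`. [cite: Federbush1990PhaseCellV, App. A p. 451] -/
def InCube (v : Fin 4 → ℤ) (R : ℕ) (x : Fin 4 → ℤ) : Prop := ∀ j, |x j - v j| ≤ R

/-- Membership in the cube is decidable. [folklore] -/
instance (v : Fin 4 → ℤ) (R : ℕ) : DecidablePred (InCube v R) := fun x => by
  unfold InCube; infer_instance

/-- The cube as a finset. [folklore] -/
def cubeSet (v : Fin 4 → ℤ) (R : ℕ) : Finset (Fin 4 → ℤ) := Fintype.piFinset fun j => Finset.Icc (v j - R) (v j + R)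

/-- `cubeSet` is the cube. [folklore] -/
private theorem mem_cubeSet {v : Fin 4 → ℤ} {R : ℕ} {x : Fin 4 → ℤ} : x ∈ cubeSet v R ↔ InCube v R x := by
  simp only [cubeSet, Fintype.mem_piFinset, Finset.mem_Icc, InCube, abs_le]
  exact forall_congr' fun j => by constructor <;> intro h <;> constructor <;> linarith [h.1, h.2]

/-- The cube of radius `R` has `(2R+1)⁴` points. [folklore] -/
private theorem card_cubeSet (v : Fin 4 → ℤ) (R : ℕ) : (cubeSet v R).card = (2 * R + 1) ^ 4 := by
  rw [cubeSet, Fintype.card_piFinset]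
  simp only [Int.card_Icc]
  have : ∀ j : Fin 4, (v j + R + 1 - (v j - R)).toNat = 2 * R + 1 := fun j => by omega
  simp [this]

/-- **The truncated gauge function** `λ_R`: the comb path sum inside the cube, `0` outside (so that `dλ_R` is finitely supported).
[cite: Federbush1990PhaseCellV, App. A p. 451] -/
def cutPot (a : Edge 0 → ℝ) (v : Fin 4 → ℤ) (R : ℕ) (x : Fin 4 → ℤ) : ℝ := if InCube v R x then combPot a v x else 0

/-- The lattice gradient `dλ(x, μ) = λ(x + e_μ) − λ(x)` — the level-0 bond variables of the pure gauge `d(interp λ)`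
(`bond_pureGauge`). [cite: Federbush1986PhaseCellI, (3.2) p. 327, §4 (4.3)–(4.5) p. 329] -/
def lgrad (lam : (Fin 4 → ℤ) → ℝ) : Edge 0 → ℝ := fun e => lam (e.base + Pi.single e.dir 1) - lam e.base

/-- Inside the cube (both ends) the `λ_R`-gauged bond variable is the comb-gauge one. [cite: Federbush1990PhaseCellV, App. A p. 451] -/
theorem sub_lgrad_cutPot_of_in {R : ℕ} {e : Edge 0} (h1 : InCube v R e.base) (h2 : InCube v R (e.base + Pi.single e.dir 1)) :
    a e - lgrad (cutPot a v R) e = combFix a v e := by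
  simp [lgrad, cutPot, combFix, h1, h2]

/-- Outside the cube (both ends) `dλ_R = 0`. [cite: Federbush1990PhaseCellV, App. A p. 451] -/
theorem lgrad_cutPot_of_out {R : ℕ} {e : Edge 0} (h1 : ¬ InCube v R e.base) (h2 : ¬ InCube v R (e.base + Pi.single e.dir 1)) :
    lgrad (cutPot a v R) e = 0 := by
  simp [lgrad, cutPot, h1, h2]

/-- The crude bound `|dλ_R| ≤ 8R·max|a|` (each end contributes a comb path of `‖·‖₁`-length `≤ 4R`).
[cite: Federbush1990PhaseCellV, App. A p. 451] -/
theorem abs_lgrad_cutPot_le {Am : ℝ} (hAm : ∀ e : Edge 0, |a e| ≤ Am) (R : ℕ) (e : Edge 0) :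
    |lgrad (cutPot a v R) e| ≤ 8 * R * Am := by
  have hAm0 : 0 ≤ Am := (abs_nonneg _).trans (hAm ⟨0, 0⟩)
  have hcut : ∀ z, |cutPot a v R z| ≤ 4 * R * Am := by
    intro z
    unfold cutPot
    split_ifs with hz
    · refine (abs_combPot_le hAm v z).trans ?_
      have hs : ∑ k : Fin 4, |((z k : ℝ) - v k)| ≤ 4 * R := by
        calc ∑ k : Fin 4, |((z k : ℝ) - v k)| ≤ ∑ _k : Fin 4, (R : ℝ) :=
              Finset.sum_le_sum fun k _ => by exact_mod_cast hz k
          _ = 4 * R := by simp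
      exact mul_le_mul_of_nonneg_right hs hAm0
    · rw [abs_zero]; positivity
  unfold lgrad
  calc |cutPot a v R (e.base + Pi.single e.dir 1) - cutPot a v R e.base|
      ≤ |cutPot a v R (e.base + Pi.single e.dir 1)| + |cutPot a v R e.base| := abs_sub _ _
    _ ≤ 4 * R * Am + 4 * R * Am := add_le_add (hcut _) (hcut _)
    _ = 8 * R * Am := by ring

/-- If `dλ_R(x, μ) ≠ 0` then `x` lies in the cube of radius `R + 1`. [cite: Federbush1990PhaseCellV, App. A p. 451] -/
theorem inCube_succ_of_lgrad_ne_zero {R : ℕ} {e : Edge 0} (h : lgrad (cutPot a v R) e ≠ 0) : InCube v (R + 1) e.base := by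
  by_contra hx
  apply h
  apply lgrad_cutPot_of_out
  · exact fun hin => hx fun j => (hin j).trans (by exact_mod_cast Nat.le_succ R)
  · intro hin
    apply hx
    intro j
    have hj := hin j
    simp only [Pi.add_apply] at hj
    by_cases hjd : j = e.dir
    · subst hjd
      rw [Pi.single_eq_same] at hj
      rw [abs_le] at hj ⊢
      push_cast
      constructor <;> linarith [hj.1, hj.2]
    · rw [Pi.single_eq_of_ne hjd, add_zero] at hj
      exact hj.trans (by exact_mod_cast Nat.le_succ R)

/-- A bond not inside the cube at both ends, but with `dλ_R ≠ 0`, reaches the boundary: some `|x_j − v_j| ≥ R`.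
[cite: Federbush1990PhaseCellV, App. A p. 451] -/
theorem exists_ge_of_not_in {R : ℕ} {e : Edge 0}
    (h : ¬ (InCube v R e.base ∧ InCube v R (e.base + Pi.single e.dir 1))) :
    ∃ j, (R : ℤ) ≤ |e.base j - v j| := by
  by_contra hall'
  have hall : ∀ j, |e.base j - v j| < R := fun j => not_le.1 fun h' => hall' ⟨j, h'⟩
  apply h
  constructor
  · exact fun j => by have := hall j; omega
  · intro j
    simp only [Pi.add_apply]
    by_cases hjd : j = e.dir
    · subst hjd
      rw [Pi.single_eq_same]
      have := hall e.dir
      rw [abs_lt] at this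
      rw [abs_le]
      constructor <;> omega
    · rw [Pi.single_eq_of_ne hjd, add_zero]
      have := hall j; omega

/-- … hence is at distance `≥ R` from `v` and `≥ R − 2` from any `y` within `2` of `v`. [cite: Federbush1990PhaseCellV, App. A p. 451] -/
theorem dist_ge_of_exists_ge {R : ℕ} {x : Fin 4 → ℤ} (h : ∃ j, (R : ℤ) ≤ |x j - v j|) {y : E4} (hyv : dist y (latPt v) ≤ 2) :
    (R : ℝ) - 2 ≤ dist y (latPt x) := by
  obtain ⟨j, hj⟩ := h
  have h1 : (R : ℝ) ≤ dist (latPt x) (latPt v) := by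
    refine le_trans ?_ (abs_sub_le_dist x v j)
    have : ((R : ℤ) : ℝ) ≤ ((|x j - v j| : ℤ) : ℝ) := by exact_mod_cast hj
    simpa using this
  have h2 := dist_triangle (latPt x) y (latPt v)
  rw [dist_comm (latPt x) y] at h2
  linarith

/-! ## §4  Lattice exponential sums: `Σ_{x} (weight) e^{−δ d(y, x)}` is bounded uniformly in the finite set of bonds -/

/-- `Z(δ) = Σ_{m ∈ ℤ} e^{−δ|m|}`. [folklore] -/
def Z1 (δ : ℝ) : ℝ := ∑' m : ℤ, Real.exp (-δ * |(m : ℝ)|)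

/-- `e^{−δ|m|}` is summable over `ℤ` (two geometric series). [folklore] -/
private theorem summable_Z1 {δ : ℝ} (hδ : 0 < δ) : Summable fun m : ℤ => Real.exp (-δ * |(m : ℝ)|) := by
  have hr : Real.exp (-δ) < 1 := Real.exp_lt_one_iff.2 (by linarith)
  have hg := summable_geometric_of_lt_one (Real.exp_pos _).le hr
  refine Summable.of_nat_of_neg_add_one ?_ ?_
  · refine hg.congr fun n => ?_
    rw [← Real.exp_nat_mul]
    congr 1
    have : |((n : ℤ) : ℝ)| = n := by rw [Int.cast_natCast, Nat.abs_cast]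
    rw [this]
    ring
  · refine ((summable_nat_add_iff 1).2 hg).congr fun n => ?_
    rw [← Real.exp_nat_mul]
    congr 1
    have : |((-((n : ℤ) + 1) : ℤ) : ℝ)| = n + 1 := by
      have hn : (0 : ℝ) ≤ n := Nat.cast_nonneg n
      push_cast
      rw [abs_of_nonpos (by linarith)]
      ring
    rw [this]
    push_cast
    ring

/-- `Z(δ) ≥ 1` (the term `m = 0`). [folklore] -/
private theorem one_le_Z1 {δ : ℝ} (hδ : 0 < δ) : 1 ≤ Z1 δ := by
  have h := (summable_Z1 hδ).le_tsum 0 fun _ _ => (Real.exp_pos _).le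
  simpa [Z1] using h

/-- `Z(δ) > 0`. [folklore] -/
private theorem Z1_pos {δ : ℝ} (hδ : 0 < δ) : 0 < Z1 δ := lt_of_lt_of_le one_pos (one_le_Z1 hδ)

/-- Any finite sum over `ℤ` of `e^{−δ|m|}` is at most `Z(δ)`. [folklore] -/
private theorem sum_le_Z1 {δ : ℝ} (hδ : 0 < δ) (S : Finset ℤ) : ∑ m ∈ S, Real.exp (-δ * |(m : ℝ)|) ≤ Z1 δ :=
  (summable_Z1 hδ).sum_le_tsum S fun _ _ => (Real.exp_pos _).le

/-- **The product trick**: `Σ_{x ∈ S} e^{−δ‖x‖} ≤ Z(δ/4)⁴` for every finite `S ⊂ ℤ⁴` (since `|x_j| ≤ ‖x‖` for each `j`).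
[folklore] -/
private theorem sum_exp_le {δ : ℝ} (hδ : 0 < δ) (S : Finset (Fin 4 → ℤ)) :
    ∑ x ∈ S, Real.exp (-δ * ‖latPt x‖) ≤ Z1 (δ / 4) ^ 4 := by
  -- termwise: e^{−δ‖x‖} ≤ Π_j e^{−(δ/4)|x_j|}
  have hterm : ∀ x : Fin 4 → ℤ, Real.exp (-δ * ‖latPt x‖) ≤ ∏ j : Fin 4, Real.exp (-(δ / 4) * |(x j : ℝ)|) := by
    intro x
    rw [← Real.exp_sum]
    refine Real.exp_le_exp.2 ?_
    have h : ∑ j : Fin 4, |(x j : ℝ)| ≤ 4 * ‖latPt x‖ := by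
      calc ∑ j : Fin 4, |(x j : ℝ)| ≤ ∑ _j : Fin 4, ‖latPt x‖ := Finset.sum_le_sum fun j _ => abs_cast_le_norm_src x 0 j
        _ = 4 * ‖latPt x‖ := by simp
    have : ∑ j : Fin 4, -(δ / 4) * |(x j : ℝ)| = -(δ / 4) * ∑ j : Fin 4, |(x j : ℝ)| := by rw [Finset.mul_sum]
    rw [this]
    nlinarith
  -- sum over S ≤ sum over the product of the coordinate projections
  set T : Finset (Fin 4 → ℤ) := Fintype.piFinset fun j => S.image fun x => x j with hT
  have hST : S ⊆ T := fun x hx => Fintype.mem_piFinset.2 fun j => Finset.mem_image.2 ⟨x, hx, rfl⟩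
  calc ∑ x ∈ S, Real.exp (-δ * ‖latPt x‖) ≤ ∑ x ∈ S, ∏ j : Fin 4, Real.exp (-(δ / 4) * |(x j : ℝ)|) :=
        Finset.sum_le_sum fun x _ => hterm x
    _ ≤ ∑ x ∈ T, ∏ j : Fin 4, Real.exp (-(δ / 4) * |(x j : ℝ)|) :=
        Finset.sum_le_sum_of_subset_of_nonneg hST fun x _ _ => Finset.prod_nonneg fun j _ => (Real.exp_pos _).le
    _ = ∏ j : Fin 4, ∑ m ∈ S.image (fun x => x j), Real.exp (-(δ / 4) * |((m : ℤ) : ℝ)|) := by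
        rw [hT, Finset.prod_univ_sum]
    _ ≤ ∏ _j : Fin 4, Z1 (δ / 4) := Finset.prod_le_prod (fun _ _ => Finset.sum_nonneg fun _ _ => (Real.exp_pos _).le)
          fun _ _ => sum_le_Z1 (by positivity) _
    _ = Z1 (δ / 4) ^ 4 := by simp

/-- `t e^{−δt} ≤ 1/δ` (from `δt ≤ e^{δt}`). [folklore] -/
private theorem mul_exp_neg_le {δ : ℝ} (hδ : 0 < δ) (t : ℝ) : t * Real.exp (-δ * t) ≤ 1 / δ := by
  have h1 : δ * t ≤ Real.exp (δ * t) := by linarith [Real.add_one_le_exp (δ * t)]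
  rw [show -δ * t = -(δ * t) by ring, Real.exp_neg]
  rw [le_div_iff₀ hδ]
  have hpos := Real.exp_pos (δ * t)
  calc t * (Real.exp (δ * t))⁻¹ * δ = (δ * t) / Real.exp (δ * t) := by ring
    _ ≤ Real.exp (δ * t) / Real.exp (δ * t) := div_le_div_of_nonneg_right h1 hpos.le
    _ = 1 := div_self hpos.ne'

/-- The multiplicity constant `C₁(δ) = (16 e^{4δ}/δ)·Z(δ/4)⁴`. [cite: Federbush1990PhaseCellV, App. A p. 451] -/
def C1 (δ : ℝ) : ℝ := 16 * Real.exp (4 * δ) / δ * Z1 (δ / 4) ^ 4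

/-- `C₁(δ) > 0`. [folklore] -/
private theorem C1_pos {δ : ℝ} (hδ : 0 < δ) : 0 < C1 δ := by
  unfold C1
  have := Z1_pos (δ := δ / 4) (by positivity)
  positivity

/-- **THE WEIGHTED LATTICE SUM**: for any finite set `E` of level-0 bonds, any centre `v ∈ ℤ⁴` and `y` within `2` of it,
`Σ_{(x,μ) ∈ E} (Σ_k |x_k − v_k|) e^{−2δ d(y, x)} ≤ C₁(δ)`. [cite: Federbush1990PhaseCellV, App. A p. 451] -/
theorem weighted_sum_le {δ : ℝ} (hδ : 0 < δ) {y : E4} (hyv : dist y (latPt v) ≤ 2) (E : Finset ((Fin 4 → ℤ) × Fin 4)) :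
    ∑ p ∈ E, (∑ k : Fin 4, |((p.1 k : ℝ) - v k)|) * Real.exp (-(2 * δ) * dist y (latPt p.1)) ≤ C1 δ := by
  -- termwise bound by `(4 e^{4δ}/δ) e^{−δ‖x − v‖}`
  have hterm : ∀ p ∈ E, (∑ k : Fin 4, |((p.1 k : ℝ) - v k)|) * Real.exp (-(2 * δ) * dist y (latPt p.1))
      ≤ 4 * Real.exp (4 * δ) / δ * Real.exp (-δ * ‖latPt (p.1 - v)‖) := by
    intro p _
    set u : ℝ := ‖latPt (p.1 - v)‖ with hu
    have hu0 : 0 ≤ u := norm_nonneg _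
    have hdist : dist (latPt p.1) (latPt v) = u := by rw [dist_eq_norm, latPt_sub]
    have h1 : ∑ k : Fin 4, |((p.1 k : ℝ) - v k)| ≤ 4 * u := by rw [← hdist]; exact sum_abs_sub_le_dist p.1 v
    have h2 : u - 2 ≤ dist y (latPt p.1) := by
      have := dist_triangle (latPt p.1) y (latPt v)
      rw [dist_comm (latPt p.1) y, hdist] at this
      linarith
    have h3 : Real.exp (-(2 * δ) * dist y (latPt p.1)) ≤ Real.exp (4 * δ) * (Real.exp (-δ * u) * Real.exp (-δ * u)) := by
      rw [← Real.exp_add, ← Real.exp_add]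
      exact Real.exp_le_exp.2 (by nlinarith)
    have h4 := mul_exp_neg_le hδ u
    calc (∑ k : Fin 4, |((p.1 k : ℝ) - v k)|) * Real.exp (-(2 * δ) * dist y (latPt p.1))
        ≤ (4 * u) * (Real.exp (4 * δ) * (Real.exp (-δ * u) * Real.exp (-δ * u))) :=
          mul_le_mul h1 h3 (Real.exp_pos _).le (by positivity)
      _ = 4 * Real.exp (4 * δ) * (u * Real.exp (-δ * u)) * Real.exp (-δ * u) := by ring
      _ ≤ 4 * Real.exp (4 * δ) * (1 / δ) * Real.exp (-δ * u) :=
          mul_le_mul_of_nonneg_right (mul_le_mul_of_nonneg_left h4 (by positivity)) (Real.exp_pos _).le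
      _ = 4 * Real.exp (4 * δ) / δ * Real.exp (-δ * ‖latPt (p.1 - v)‖) := by rw [hu]; ring
  refine (Finset.sum_le_sum hterm).trans ?_
  rw [← Finset.mul_sum]
  -- the sum over `E` of `e^{−δ‖x − v‖}`: at most 4 directions × the sum over the translated base points
  have hE : ∑ p ∈ E, Real.exp (-δ * ‖latPt (p.1 - v)‖)
      ≤ ∑ q ∈ (E.image fun p => p.1 - v) ×ˢ (Finset.univ : Finset (Fin 4)), Real.exp (-δ * ‖latPt q.1‖) := by
    set φ : (Fin 4 → ℤ) × Fin 4 → (Fin 4 → ℤ) × Fin 4 := fun p => (p.1 - v, p.2) with hφ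
    have hinj : Set.InjOn φ ↑E := by
      intro p _ p' _ h
      simp only [hφ, Prod.mk.injEq, sub_left_inj] at h
      exact Prod.ext h.1 h.2
    have h1 : ∑ p ∈ E, Real.exp (-δ * ‖latPt (p.1 - v)‖) = ∑ q ∈ E.image φ, Real.exp (-δ * ‖latPt q.1‖) := by
      rw [Finset.sum_image hinj]
    rw [h1]
    refine Finset.sum_le_sum_of_subset_of_nonneg (fun q hq => ?_) fun _ _ _ => (Real.exp_pos _).le
    obtain ⟨p, hp, rfl⟩ := Finset.mem_image.1 hq
    exact Finset.mem_product.2 ⟨Finset.mem_image.2 ⟨p, hp, rfl⟩, Finset.mem_univ _⟩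
  have hprod : ∑ q ∈ (E.image fun p => p.1 - v) ×ˢ (Finset.univ : Finset (Fin 4)), Real.exp (-δ * ‖latPt q.1‖)
      = 4 * ∑ x ∈ E.image (fun p => p.1 - v), Real.exp (-δ * ‖latPt x‖) := by
    rw [Finset.sum_product, Finset.mul_sum]
    refine Finset.sum_congr rfl fun x _ => ?_
    simp [Finset.sum_const, nsmul_eq_mul]
  have hZ := sum_exp_le hδ (E.image fun p => p.1 - v)
  unfold C1
  have hc : 0 ≤ 4 * Real.exp (4 * δ) / δ := by positivity
  calc 4 * Real.exp (4 * δ) / δ * ∑ p ∈ E, Real.exp (-δ * ‖latPt (p.1 - v)‖)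
      ≤ 4 * Real.exp (4 * δ) / δ * (4 * Z1 (δ / 4) ^ 4) := by
        refine mul_le_mul_of_nonneg_left ?_ hc
        exact hE.trans (hprod.le.trans (by linarith))
    _ = 16 * Real.exp (4 * δ) / δ * Z1 (δ / 4) ^ 4 := by ring


/-! ## §5  Boxes of bonds and plaquettes; the weighted `ℓ¹` norm `Φ = Σ_P |F(P)| e^{−γ′d(y,P)}` of the plaquette data -/

open BondRealization (box mem_box)

/-- The level-0 bonds with base point in `box M`. [cite: Federbush1986PhaseCellI, §3 p. 327] -/
abbrev bondBox (M : ℕ) : Finset ((Fin 4 → ℤ) × Fin 4) := box M ×ˢ (Finset.univ : Finset (Fin 4))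

/-- A level-0 plaquette from its integer labels (an embedding). [cite: Federbush1986PhaseCellI, Fig. 4 p. 324] -/
def plaqOfTriple : ((Fin 4 → ℤ) × Fin 4) × Fin 4 ↪ Plaq 0 :=
  ⟨fun t => ⟨t.1.1, t.1.2, t.2⟩, fun t t' h => by
    simp only [Plaq.mk.injEq] at h
    exact Prod.ext (Prod.ext h.1 h.2.1) h.2.2⟩

/-- The level-0 plaquettes with base point in `box M` (print's `P ∈ 𝒫^r`, restricted to where the data live).
[cite: Federbush1990PhaseCellV, (A.1) p. 451] -/
def plaqBox (M : ℕ) : Finset (Plaq 0) :=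
  ((box M ×ˢ (Finset.univ : Finset (Fin 4))) ×ˢ (Finset.univ : Finset (Fin 4))).map plaqOfTriple

/-- Membership in `plaqBox`. [cite: Federbush1990PhaseCellV, (A.1) p. 451] -/
theorem mem_plaqBox {M : ℕ} {P : Plaq 0} : P ∈ plaqBox M ↔ P.base ∈ box M := by
  constructor
  · intro h
    obtain ⟨t, ht, rfl⟩ := Finset.mem_map.1 h
    exact (Finset.mem_product.1 (Finset.mem_product.1 ht).1).1
  · intro h
    refine Finset.mem_map.2 ⟨((P.base, P.dir₁), P.dir₂), ?_, rfl⟩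
    simp [h]

/-- `box M ⊆ box (M+1)`. [folklore] -/
private theorem box_subset_succ {M : ℕ} {x : Fin 4 → ℤ} (h : x ∈ box M) : x ∈ box (M + 1) :=
  mem_box.2 fun k => (mem_box.1 h k).trans (by exact_mod_cast Nat.le_succ M)

/-- If `x + e_μ ∈ box M` then `x ∈ box (M+1)`. [folklore] -/
private theorem mem_box_succ_of_add_single {M : ℕ} {x : Fin 4 → ℤ} {μ : Fin 4} (h : x + Pi.single μ 1 ∈ box M) :
    x ∈ box (M + 1) := by
  refine mem_box.2 fun k => ?_
  have hk := mem_box.1 h k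
  simp only [Pi.add_apply] at hk
  by_cases hkμ : k = μ
  · subst hkμ
    rw [Pi.single_eq_same] at hk
    rw [abs_le] at hk ⊢; push_cast; constructor <;> linarith [hk.1, hk.2]
  · rw [Pi.single_eq_of_ne hkμ, add_zero] at hk
    exact hk.trans (by exact_mod_cast Nat.le_succ M)

/-- Box-supported data have box-supported plaquette variables (one box larger). [cite: Federbush1986PhaseCellI, (1.4) p. 322] -/
theorem plaqOfBonds_eq_zero_of_not_mem {M : ℕ} (ha : ∀ e : Edge 0, e.base ∉ box M → a e = 0) {P : Plaq 0}
    (hP : P.base ∉ box (M + 1)) : plaqOfBonds a P = 0 := by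
  have h0 : P.base ∉ box M := fun h => hP (box_subset_succ h)
  have h1 : P.base + Pi.single P.dir₁ 1 ∉ box M := fun h => hP (mem_box_succ_of_add_single h)
  have h2 : P.base + Pi.single P.dir₂ 1 ∉ box M := fun h => hP (mem_box_succ_of_add_single h)
  simp [plaqOfBonds, ha ⟨P.base, P.dir₁⟩ h0, ha ⟨P.base, P.dir₂⟩ h0, ha ⟨_, P.dir₂⟩ h1, ha ⟨_, P.dir₁⟩ h2]

/-- A lattice gauge function supported in `box M` has gradient supported in `box (M+1)`. [cite: Federbush1986PhaseCellI, (3.2) p. 327] -/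
theorem lgrad_eq_zero_of_not_mem {M : ℕ} {lam : (Fin 4 → ℤ) → ℝ} (hlam : ∀ x, x ∉ box M → lam x = 0) (e : Edge 0)
    (he : e.base ∉ box (M + 1)) : lgrad lam e = 0 := by
  have h0 : e.base ∉ box M := fun h => he (box_subset_succ h)
  have h1 : e.base + Pi.single e.dir 1 ∉ box M := fun h => he (mem_box_succ_of_add_single h)
  simp [lgrad, hlam _ h0, hlam _ h1]

/-- **Print's right-hand side**: `Φ(y) = Σ_{P} |A_{∂P}| e^{−γ′ d(y, P)}` over the level-0 plaquettes (those in `plaqBox (M+1)`,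
outside of which the plaquette variables of `box M`-supported data vanish). [cite: Federbush1990PhaseCellV, (A.1)–(A.2) p. 451] -/
def phiSum (a : Edge 0 → ℝ) (M : ℕ) (γ' : ℝ) (y : E4) : ℝ :=
  ∑ P ∈ plaqBox (M + 1), |plaqOfBonds a P| * Real.exp (-γ' * dist y P.src)

/-- `Φ ≥ 0`. [cite: Federbush1990PhaseCellV, (A.1) p. 451] -/
theorem phiSum_nonneg (a : Edge 0 → ℝ) (M : ℕ) (γ' : ℝ) (y : E4) : 0 ≤ phiSum a M γ' y :=
  Finset.sum_nonneg fun _ _ => mul_nonneg (abs_nonneg _) (Real.exp_pos _).le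

/-- Each plaquette's weighted variable is at most `Φ`. [cite: Federbush1990PhaseCellV, (A.1) p. 451] -/
theorem single_le_phiSum {M : ℕ} (ha : ∀ e : Edge 0, e.base ∉ box M → a e = 0) (γ' : ℝ) (y : E4) (P : Plaq 0) :
    |plaqOfBonds a P| * Real.exp (-γ' * dist y P.src) ≤ phiSum a M γ' y := by
  by_cases hP : P.base ∈ box (M + 1)
  · exact Finset.single_le_sum (f := fun P : Plaq 0 => |plaqOfBonds a P| * Real.exp (-γ' * dist y P.src))
      (fun _ _ => mul_nonneg (abs_nonneg _) (Real.exp_pos _).le) (mem_plaqBox.2 hP)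
  · rw [plaqOfBonds_eq_zero_of_not_mem ha hP, abs_zero, zero_mul]
    exact phiSum_nonneg a M γ' y

/-! ## §6  «Of course this does not change plaquette assignments»: the plaquette variables of the superposition minimiser
are gauge invariant functionals of the data -/

open ModeTranslation (unitData)
open ModeEstimatesSuperposition (superpose plaq_superpose shiftBase)

variable {N : Fin 4 → E4 → Fin 4 → ℝ}

/-- `gaugeTransform 0 Λ = dΛ`. [cite: Federbush1986PhaseCellI, (3.2) p. 327] -/
theorem gaugeTransform_zero (Λ : E4 → ℝ) : AbelianAveraging.gaugeTransform 0 Λ = pureGauge Λ := by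
  funext x μ
  simp [AbelianAveraging.gaugeTransform, pureGauge]

/-- **THE SUPERPOSITION MINIMISER OF PURE-GAUGE DATA IS FLAT, so all its plaquette variables vanish.**  For a finitely supported
lattice gauge function `λ`, the constrained minimiser `Σ_e dλ(e) N_e` of the data `dλ` has the zero-action competitor
`d(interp λ)` (same level-0 bond variables by «Mirabile dictu», `bond_pureGauge`), hence zero action, hence zero field strength,
hence — Green's identity on every plaquette and (1.14) — zero plaquette variables at every level.
[cite: Federbush1990PhaseCellV, App. A p. 451 («Of course this does not change plaquette assignments»); Federbush1986PhaseCellI,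
(3.2) p. 327, §4 p. 329, (1.13)–(1.14) p. 324] -/
theorem plaq_superpose_lgrad (hN : ∀ μ, axialTreeAveraging.IsConstrainedMinimizer 0 (unitData 0 μ) (N μ)) {M : ℕ}
    {lam : (Fin 4 → ℤ) → ℝ} (hlam : ∀ x, x ∉ box M → lam x = 0) (s : ℕ) (q : Plaq s) :
    axialTreeAveraging.plaq s (superpose (bondBox (M + 1)) (lgrad lam) N) q = 0 := by
  set S := superpose (bondBox (M + 1)) (lgrad lam) N with hS
  have hmin : axialTreeAveraging.IsConstrainedMinimizer 0 (lgrad lam) S :=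
    (ModeTranslation.isConstrainedMinimizer_superposition hN (lgrad_eq_zero_of_not_mem hlam)).1
  -- the zero-action competitor `d(interp λ)`
  have hΛ : ContDiff ℝ ∞ (LatticeGauge.interp lam) := LatticeGauge.contDiff_interp lam
  have hΛ1 : ContDiff ℝ 1 (LatticeGauge.interp lam) := contDiff_infty.1 hΛ 1
  have hP1 : ContDiff ℝ 1 (pureGauge (LatticeGauge.interp lam)) := by
    rw [← gaugeTransform_zero]
    exact AbelianAveraging.contDiff_gaugeTransform contDiff_const hΛ
  have hPb : axialTreeAveraging.bond 0 (pureGauge (LatticeGauge.interp lam)) = lgrad lam := by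
    funext e
    obtain ⟨n, i⟩ := e
    rw [bond_pureGauge hΛ1 n i]
    have h1 := LatticeGauge.interp_latPt lam (n + Pi.single i 1)
    have h2 := LatticeGauge.interp_latPt lam n
    dsimp only [LatticeGauge.latPt] at h1 h2
    rw [h1, h2]
    rfl
  have hP0 : contAction (pureGauge (LatticeGauge.interp lam)) = 0 := by
    have h := AbelianAveraging.contAction_gaugeTransform (AN := (0 : E4 → Fin 4 → ℝ)) contDiff_const hΛ
    rw [gaugeTransform_zero] at h
    rw [h]
    exact ModeLinearity.contAction_zero
  have h0 : contAction S = 0 :=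
    le_antisymm ((hmin.2.2 _ hP1 hPb).trans hP0.le) bot_le
  have hflat := ModeLinearity.fieldStrength_eq_zero_of_contAction_eq_zero hmin.1 h0
  -- Green's identity on every plaquette: all loop integrals vanish
  have hloop : ∀ (z : E4) (i j : Fin 4) (ℓ : ℝ), loopInt S z i j ℓ = 0 := by
    intro z i j ℓ
    unfold loopInt lineInt
    rw [PlaquetteStokes.loop_eq_integral_curl S hmin.1 z ℓ i j]
    have hz : ∀ w : E4, fderiv ℝ (fun y => S y j) w (unitVec i) - fderiv ℝ (fun y => S y i) w (unitVec j) = 0 :=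
      fun w => hflat i j w
    simp [hz]
  rw [axialTreeAveraging_plaq_eq_plaqFunctional hmin.1 s q]
  simp [plaqFunctional, hloop]

/-- The kernel `Π_e(q)`: the plaquette variable at `q` of the unit-configuration mode of the bond `e = (b, μ)` translated to `b`.
[cite: Federbush1986PhaseCellI, §3 p. 327] -/
def kernel (N : Fin 4 → E4 → Fin 4 → ℝ) (s : ℕ) (q : Plaq s) (p : (Fin 4 → ℤ) × Fin 4) : ℝ :=
  axialTreeAveraging.plaq s (N p.2) ⟨shiftBase s p.1 q.base, q.dir₁, q.dir₂⟩

/-- `A_{∂q} = Σ_e a(e) Π_e(q)` for the superposition. [cite: Federbush1986PhaseCellI, §3 p. 327] -/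
theorem plaq_superpose_eq_sum (hN : ∀ μ, ContDiff ℝ 1 (N μ)) (F : Finset ((Fin 4 → ℤ) × Fin 4)) (a : Edge 0 → ℝ)
    (s : ℕ) (q : Plaq s) :
    axialTreeAveraging.plaq s (superpose F a N) q = ∑ p ∈ F, a ⟨p.1, p.2⟩ * kernel N s q p := by
  obtain ⟨n, d₁, d₂⟩ := q
  exact plaq_superpose hN F a s ⟨n, d₁, d₂⟩

/-- **GAUGE INVARIANCE OF THE PLAQUETTE FUNCTIONAL**: for data `a` supported in `box M` and any lattice gauge function `λ`
supported in `box M′ ⊇ box M`, `Σ_e a(e)Π_e(q) = Σ_e (a − dλ)(e)Π_e(q)` (sums over any box of bonds containing the supports).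
[cite: Federbush1990PhaseCellV, App. A p. 451; Federbush1986PhaseCellI, (3.2) p. 327] -/
theorem sum_kernel_gauge (hN : ∀ μ, axialTreeAveraging.IsConstrainedMinimizer 0 (unitData 0 μ) (N μ)) {M M' : ℕ}
    (hMM' : M ≤ M') (ha : ∀ e : Edge 0, e.base ∉ box M → a e = 0) {lam : (Fin 4 → ℤ) → ℝ}
    (hlam : ∀ x, x ∉ box M' → lam x = 0) (s : ℕ) (q : Plaq s) :
    ∑ p ∈ bondBox M, a ⟨p.1, p.2⟩ * kernel N s q p
      = ∑ p ∈ bondBox (M' + 1), (a ⟨p.1, p.2⟩ - lgrad lam ⟨p.1, p.2⟩) * kernel N s q p := by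
  have hN1 : ∀ μ, ContDiff ℝ 1 (N μ) := fun μ => (hN μ).1
  have hzero : ∑ p ∈ bondBox (M' + 1), lgrad lam ⟨p.1, p.2⟩ * kernel N s q p = 0 := by
    rw [← plaq_superpose_eq_sum hN1]
    exact plaq_superpose_lgrad hN hlam s q
  have hsub : bondBox M ⊆ bondBox (M' + 1) := by
    refine Finset.product_subset_product (fun x hx => mem_box.2 fun k => (mem_box.1 hx k).trans ?_) le_rfl
    exact_mod_cast hMM'.trans (Nat.le_succ M')
  have hext : ∑ p ∈ bondBox M, a ⟨p.1, p.2⟩ * kernel N s q p = ∑ p ∈ bondBox (M' + 1), a ⟨p.1, p.2⟩ * kernel N s q p := by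
    refine Finset.sum_subset hsub fun p hp hpM => ?_
    have : p.1 ∉ box M := fun h => hpM (Finset.mem_product.2 ⟨h, Finset.mem_univ _⟩)
    rw [ha ⟨p.1, p.2⟩ this, zero_mul]
  rw [hext]
  simp only [sub_mul, Finset.sum_sub_distrib, hzero, sub_zero]

/-! ## §7  THE CORE ESTIMATE: a gauge-invariant pairing `Σ_e a(e)Π_e` with an exponentially localised kernel is bounded by
the weighted `ℓ¹` norm of the PLAQUETTE variables of `a` — radial axial (comb) gauge, truncation, exchange of sums, `R → ∞` -/

/-- `ℓ_∞`-size of `v`. [folklore] -/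
def supNorm (v : Fin 4 → ℤ) : ℕ := Finset.univ.sup fun j => (v j).natAbs

/-- `|v_j| ≤ ‖v‖_∞`. [folklore] -/
private theorem natAbs_le_supNorm (v : Fin 4 → ℤ) (j : Fin 4) : (v j).natAbs ≤ supNorm v :=
  Finset.le_sup (f := fun j => (v j).natAbs) (Finset.mem_univ j)

/-- `box M ⊆ cube_v(M + ‖v‖_∞)`-type inclusion: points of `box M` are within `M + ‖v‖_∞` of `v` coordinatewise. [folklore] -/
private theorem abs_sub_le_of_mem_box {M : ℕ} {x : Fin 4 → ℤ} (hx : x ∈ box M) (j : Fin 4) :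
    |x j - v j| ≤ (M : ℤ) + supNorm v := by
  have h1 := mem_box.1 hx j
  have h2 : ((v j).natAbs : ℤ) ≤ supNorm v := by exact_mod_cast natAbs_le_supNorm v j
  have h3 : |v j| = ((v j).natAbs : ℤ) := (Int.natCast_natAbs (v j)).symm
  calc |x j - v j| ≤ |x j| + |v j| := abs_sub _ _
    _ ≤ M + supNorm v := by rw [h3]; exact add_le_add h1 h2

/-- Points of the cube of radius `R` about `v` lie in `box (‖v‖_∞ + R)`. [folklore] -/
private theorem mem_box_of_inCube {R : ℕ} {x : Fin 4 → ℤ} (hx : InCube v R x) : x ∈ box (supNorm v + R) := by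
  refine mem_box.2 fun j => ?_
  have h1 := hx j
  have h2 : ((v j).natAbs : ℤ) ≤ supNorm v := by exact_mod_cast natAbs_le_supNorm v j
  have h3 : |v j| = ((v j).natAbs : ℤ) := (Int.natCast_natAbs (v j)).symm
  calc |x j| = |(x j - v j) + v j| := by ring_nf
    _ ≤ |x j - v j| + |v j| := abs_add_le _ _
    _ ≤ ((supNorm v + R : ℕ) : ℤ) := by rw [h3]; push_cast; linarith

/-- The polynomially-weighted exponential tail `32·R·(2R+3)⁴·Am·e^{−γ(R−2)} → 0`. [folklore] -/
private theorem tendsto_tail {γ : ℝ} (hγ : 0 < γ) (C : ℝ) :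
    Tendsto (fun R : ℕ => C * R * (2 * R + 3) ^ 4 * Real.exp (-γ * ((R : ℝ) - 2))) atTop (𝓝 0) := by
  -- `w(R) = (γ/2)(2R+3) → ∞`, and the expression is `≤ C' · w^5 e^{−w}` in absolute value
  have hw : Tendsto (fun R : ℕ => γ / 2 * (2 * (R : ℝ) + 3)) atTop atTop := by
    refine Tendsto.const_mul_atTop (by positivity) ?_
    refine tendsto_atTop_add_const_right _ 3 ?_
    exact Tendsto.const_mul_atTop two_pos tendsto_natCast_atTop_atTop
  have hlim := (Real.tendsto_pow_mul_exp_neg_atTop_nhds_zero 5).comp hw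
  have hlim' : Tendsto (fun R : ℕ => |C| * (2 / γ) ^ 5 * Real.exp (γ / 2 * 7)
      * ((γ / 2 * (2 * (R : ℝ) + 3)) ^ 5 * Real.exp (-(γ / 2 * (2 * (R : ℝ) + 3))))) atTop (𝓝 0) := by
    have := hlim.const_mul (|C| * (2 / γ) ^ 5 * Real.exp (γ / 2 * 7))
    rw [mul_zero] at this
    exact this
  refine squeeze_zero_norm (fun R => ?_) hlim'
  rw [Real.norm_eq_abs]
  have hR : (0 : ℝ) ≤ R := Nat.cast_nonneg R
  set u : ℝ := 2 * (R : ℝ) + 3 with hu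
  have hu0 : 0 < u := by positivity
  have hRu : (R : ℝ) ≤ u := by linarith
  have hexp : Real.exp (-γ * ((R : ℝ) - 2)) = Real.exp (γ / 2 * 7) * Real.exp (-(γ / 2 * u)) := by
    rw [← Real.exp_add]; congr 1; rw [hu]; ring
  have hpow : (γ / 2 * u) ^ 5 = (γ / 2) ^ 5 * u ^ 5 := by ring
  rw [abs_mul, abs_mul, abs_mul, abs_of_nonneg hR, abs_of_nonneg (by positivity : (0 : ℝ) ≤ u ^ 4),
    abs_of_nonneg (Real.exp_pos _).le, hexp, hpow]
  have hγ5 : (2 / γ) ^ 5 * (γ / 2) ^ 5 = 1 := by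
    rw [← mul_pow]; rw [show 2 / γ * (γ / 2) = 1 by field_simp]; simp
  have hkey : (R : ℝ) * u ^ 4 ≤ u ^ 5 := by
    calc (R : ℝ) * u ^ 4 ≤ u * u ^ 4 := mul_le_mul_of_nonneg_right hRu (by positivity)
      _ = u ^ 5 := by ring
  calc |C| * R * u ^ 4 * (Real.exp (γ / 2 * 7) * Real.exp (-(γ / 2 * u)))
      = |C| * Real.exp (γ / 2 * 7) * (R * u ^ 4) * Real.exp (-(γ / 2 * u)) := by ring
    _ ≤ |C| * Real.exp (γ / 2 * 7) * u ^ 5 * Real.exp (-(γ / 2 * u)) :=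
        mul_le_mul_of_nonneg_right (mul_le_mul_of_nonneg_left hkey (by positivity)) (Real.exp_pos _).le
    _ = |C| * (2 / γ) ^ 5 * Real.exp (γ / 2 * 7) * ((γ / 2) ^ 5 * u ^ 5 * Real.exp (-(γ / 2 * u))) := by
        have : |C| * Real.exp (γ / 2 * 7) * u ^ 5
            = |C| * ((2 / γ) ^ 5 * (γ / 2) ^ 5) * Real.exp (γ / 2 * 7) * u ^ 5 := by rw [hγ5]; ring
        rw [this]; ring

set_option maxHeartbeats 400000 in
/-- **THE CORE ESTIMATE.**  Let `Π` be a kernel on the level-0 bonds with `|Π(x, μ)| ≤ W e^{−γ d(y, x)}`, `y` within `2` of the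
lattice point `v`, and suppose the pairing `a ↦ Σ_e a(e)Π(e)` is invariant under finitely supported lattice gauge transformations
of box-supported data.  Then for data `a` supported in `box M` and every `γ′ ∈ (0, γ)`:
`|Σ_e a(e)Π(e)| ≤ W · e^{4γ′} C₁((γ−γ′)/2) · Σ_P |A_{∂P}| e^{−γ′ d(y, P)}` — the bound is by the PLAQUETTE variables of `a`.
Proof = print's: comb («radial axial») gauge about `v`, truncated at radius `R`, `R → ∞`.
[cite: Federbush1990PhaseCellV, App. A, Lemma A.1 and its proof, p. 451; Federbush1987PhaseCellIII, Lemma 5.5 p. 300–301] -/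
theorem pairing_bound {Kf : (Fin 4 → ℤ) × Fin 4 → ℝ} {W γ γ' : ℝ} {y : E4} {v : Fin 4 → ℤ} {a : Edge 0 → ℝ} {M : ℕ}
    (hW : 0 ≤ W) (hγ' : 0 < γ') (hγ'γ : γ' < γ) (hyv : dist y (latPt v) ≤ 2)
    (hKf : ∀ p, |Kf p| ≤ W * Real.exp (-γ * dist y (latPt p.1)))
    (ha : ∀ e : Edge 0, e.base ∉ box M → a e = 0)
    (hinv : ∀ (M' : ℕ) (lam : (Fin 4 → ℤ) → ℝ), M ≤ M' → (∀ x, x ∉ box M' → lam x = 0) →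
      ∑ p ∈ bondBox M, a ⟨p.1, p.2⟩ * Kf p = ∑ p ∈ bondBox (M' + 1), (a ⟨p.1, p.2⟩ - lgrad lam ⟨p.1, p.2⟩) * Kf p) :
    |∑ p ∈ bondBox M, a ⟨p.1, p.2⟩ * Kf p|
      ≤ W * (Real.exp (4 * γ') * C1 ((γ - γ') / 2)) * phiSum a M γ' y := by
  -- notation
  have hγ0 : 0 < γ := hγ'.trans hγ'γ
  set δ : ℝ := (γ - γ') / 2 with hδ
  have hδ0 : 0 < δ := by rw [hδ]; linarith
  set Φ := phiSum a M γ' y with hΦ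
  have hΦ0 : 0 ≤ Φ := phiSum_nonneg a M γ' y
  -- a bound on the data
  obtain ⟨Am, hAm⟩ : ∃ Am : ℝ, ∀ e : Edge 0, |a e| ≤ Am := by
    refine ⟨(bondBox M).sup' ?_ (fun p => |a ⟨p.1, p.2⟩|) ⊔ 0, fun e => ?_⟩
    · exact ⟨(0, 0), Finset.mem_product.2 ⟨mem_box.2 fun k => by simp, Finset.mem_univ _⟩⟩
    · obtain ⟨b, μ⟩ := e
      by_cases he : b ∈ box M
      · exact le_sup_of_le_left (Finset.le_sup' (fun p : (Fin 4 → ℤ) × Fin 4 => |a ⟨p.1, p.2⟩|)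
          (b := (b, μ)) (Finset.mem_product.2 ⟨he, Finset.mem_univ μ⟩))
      · rw [ha ⟨b, μ⟩ he, abs_zero]; exact le_sup_right
  have hAm0 : 0 ≤ Am := (abs_nonneg _).trans (hAm ⟨0, 0⟩)
  -- THE ESTIMATE AT FIXED CUT-OFF RADIUS `R ≥ R₀`
  have main : ∀ R : ℕ, M + supNorm v + 1 ≤ R → |∑ p ∈ bondBox M, a ⟨p.1, p.2⟩ * Kf p|
      ≤ W * (Real.exp (4 * γ') * C1 δ) * Φ + W * (32 * R * (2 * R + 3) ^ 4 * Am * Real.exp (-γ * ((R : ℝ) - 2))) := by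
    intro R hR
    -- the truncated comb gauge function `λ_R = cutPot a v R` is supported in `box (‖v‖_∞ + R)`
    have hMM' : M ≤ supNorm v + R := by omega
    have hlam0 : ∀ x, x ∉ box (supNorm v + R) → cutPot a v R x = 0 := by
      intro x hx
      have : ¬ InCube v R x := fun h => hx (mem_box_of_inCube h)
      simp [cutPot, this]
    rw [hinv (supNorm v + R) (cutPot a v R) hMM' hlam0]
    -- data vanish on bonds reaching the boundary of the cube
    have ha' : ∀ p : (Fin 4 → ℤ) × Fin 4, (∃ j, (R : ℤ) ≤ |p.1 j - v j|) → a ⟨p.1, p.2⟩ = 0 := by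
      rintro p ⟨j, hj⟩
      refine ha ⟨p.1, p.2⟩ fun hx => ?_
      have h' := abs_sub_le_of_mem_box (v := v) (x := p.1) hx j
      omega
    -- INSIDE THE CUBE (both ends): comb gauge = flux of plaquette variables, each `≤ Φ e^{γ′(d(y,x)+4)}`
    have hin : ∀ p : (Fin 4 → ℤ) × Fin 4, InCube v R p.1 → InCube v R (p.1 + Pi.single p.2 1) →
        |(a ⟨p.1, p.2⟩ - lgrad (cutPot a v R) ⟨p.1, p.2⟩) * Kf p|
          ≤ W * Real.exp (4 * γ') * Φ
              * ((∑ k : Fin 4, |((p.1 k : ℝ) - v k)|) * Real.exp (-(2 * δ) * dist y (latPt p.1))) := by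
      intro p h1 h2
      rw [abs_mul, sub_lgrad_cutPot_of_in (e := ⟨p.1, p.2⟩) h1 h2]
      have hflux : |combFix a v ⟨p.1, p.2⟩|
          ≤ (∑ k : Fin 4, |((p.1 k : ℝ) - v k)|) * (Φ * Real.exp (γ' * (dist y (latPt p.1) + 4))) := by
        refine (abs_combFix_le a v p.1 p.2).trans (fluxAbs_le (by positivity) fun k t _ ht => ?_)
        have hdP := dist_plaq_le (v := v) (x := p.1) hyv (k := k) (μ := p.2) ht
        have hsing := single_le_phiSum ha γ' y ⟨segPt v p.1 k t, k, p.2⟩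
        have hexp : (1 : ℝ) ≤ Real.exp (-γ' * dist y (⟨segPt v p.1 k t, k, p.2⟩ : Plaq 0).src)
            * Real.exp (γ' * (dist y (latPt p.1) + 4)) := by
          rw [← Real.exp_add]; exact Real.one_le_exp (by nlinarith)
        calc |plaqOfBonds a ⟨segPt v p.1 k t, k, p.2⟩|
            = |plaqOfBonds a ⟨segPt v p.1 k t, k, p.2⟩| * 1 := (mul_one _).symm
          _ ≤ |plaqOfBonds a ⟨segPt v p.1 k t, k, p.2⟩| * (Real.exp (-γ' * dist y (⟨segPt v p.1 k t, k, p.2⟩ : Plaq 0).src)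
                * Real.exp (γ' * (dist y (latPt p.1) + 4))) := mul_le_mul_of_nonneg_left hexp (abs_nonneg _)
          _ = (|plaqOfBonds a ⟨segPt v p.1 k t, k, p.2⟩| * Real.exp (-γ' * dist y (⟨segPt v p.1 k t, k, p.2⟩ : Plaq 0).src))
                * Real.exp (γ' * (dist y (latPt p.1) + 4)) := by ring
          _ ≤ Φ * Real.exp (γ' * (dist y (latPt p.1) + 4)) := mul_le_mul_of_nonneg_right hsing (Real.exp_pos _).le
      have hrate : Real.exp (γ' * (dist y (latPt p.1) + 4)) * Real.exp (-γ * dist y (latPt p.1))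
          = Real.exp (4 * γ') * Real.exp (-(2 * δ) * dist y (latPt p.1)) := by
        rw [← Real.exp_add, ← Real.exp_add]; congr 1; rw [hδ]; ring
      calc |combFix a v ⟨p.1, p.2⟩| * |Kf p|
          ≤ ((∑ k : Fin 4, |((p.1 k : ℝ) - v k)|) * (Φ * Real.exp (γ' * (dist y (latPt p.1) + 4))))
              * (W * Real.exp (-γ * dist y (latPt p.1))) :=
            mul_le_mul hflux (hKf p) (abs_nonneg _) (mul_nonneg (Finset.sum_nonneg fun _ _ => abs_nonneg _) (by positivity))
        _ = W * Φ * (∑ k : Fin 4, |((p.1 k : ℝ) - v k)|)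
              * (Real.exp (γ' * (dist y (latPt p.1) + 4)) * Real.exp (-γ * dist y (latPt p.1))) := by ring
        _ = _ := by rw [hrate]; ring
    -- ACROSS THE CUT: data vanish, `|dλ_R| ≤ 8R·Am`, kernel `≤ W e^{−γ(R−2)}`, and such bonds start in the cube of radius `R+1`
    have hout : ∀ p : (Fin 4 → ℤ) × Fin 4, ¬ (InCube v R p.1 ∧ InCube v R (p.1 + Pi.single p.2 1)) →
        |(a ⟨p.1, p.2⟩ - lgrad (cutPot a v R) ⟨p.1, p.2⟩) * Kf p|
          ≤ if p.1 ∈ cubeSet v (R + 1) then 8 * R * Am * (W * Real.exp (-γ * ((R : ℝ) - 2))) else 0 := by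
      intro p hng
      have hex : ∃ j, (R : ℤ) ≤ |p.1 j - v j| := exists_ge_of_not_in (v := v) (e := ⟨p.1, p.2⟩) hng
      by_cases hz : lgrad (cutPot a v R) ⟨p.1, p.2⟩ = 0
      · rw [ha' p hex, hz, sub_zero, zero_mul, abs_zero]
        split_ifs
        · positivity
        · exact le_rfl
      · have hcube : p.1 ∈ cubeSet v (R + 1) :=
          mem_cubeSet.2 (inCube_succ_of_lgrad_ne_zero (v := v) (a := a) (e := ⟨p.1, p.2⟩) hz)
        rw [if_pos hcube, ha' p hex, zero_sub, abs_mul, abs_neg]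
        refine mul_le_mul (abs_lgrad_cutPot_le hAm R _) ((hKf p).trans ?_) (abs_nonneg _) (by positivity)
        refine mul_le_mul_of_nonneg_left (Real.exp_le_exp.2 ?_) hW
        have hd := dist_ge_of_exists_ge (v := v) (x := p.1) hex hyv
        nlinarith
    -- sum the two termwise bounds over the box of bonds
    have hsumA : ∑ p ∈ bondBox (supNorm v + R + 1), W * Real.exp (4 * γ') * Φ
          * ((∑ k : Fin 4, |((p.1 k : ℝ) - v k)|) * Real.exp (-(2 * δ) * dist y (latPt p.1)))
        ≤ W * (Real.exp (4 * γ') * C1 δ) * Φ := by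
      rw [← Finset.mul_sum]
      calc W * Real.exp (4 * γ') * Φ * _ ≤ W * Real.exp (4 * γ') * Φ * C1 δ :=
            mul_le_mul_of_nonneg_left (weighted_sum_le hδ0 hyv _) (by positivity)
        _ = W * (Real.exp (4 * γ') * C1 δ) * Φ := by ring
    have hsumB : ∑ p ∈ bondBox (supNorm v + R + 1),
          (if p.1 ∈ cubeSet v (R + 1) then 8 * R * Am * (W * Real.exp (-γ * ((R : ℝ) - 2))) else 0)
        ≤ W * (32 * R * (2 * R + 3) ^ 4 * Am * Real.exp (-γ * ((R : ℝ) - 2))) := by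
      rw [← Finset.sum_filter, Finset.sum_const, nsmul_eq_mul]
      have hcard : ((bondBox (supNorm v + R + 1)).filter fun p => p.1 ∈ cubeSet v (R + 1)).card
          ≤ (cubeSet v (R + 1) ×ˢ (Finset.univ : Finset (Fin 4))).card :=
        Finset.card_le_card fun p hp => Finset.mem_product.2 ⟨(Finset.mem_filter.1 hp).2, Finset.mem_univ _⟩
      rw [Finset.card_product, card_cubeSet, Finset.card_univ, Fintype.card_fin] at hcard
      calc (((bondBox (supNorm v + R + 1)).filter fun p => p.1 ∈ cubeSet v (R + 1)).card : ℝ)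
            * (8 * R * Am * (W * Real.exp (-γ * ((R : ℝ) - 2))))
          ≤ (((2 * (R + 1) + 1) ^ 4 * 4 : ℕ) : ℝ) * (8 * R * Am * (W * Real.exp (-γ * ((R : ℝ) - 2)))) :=
            mul_le_mul_of_nonneg_right (by exact_mod_cast hcard) (by positivity)
        _ = W * (32 * R * (2 * R + 3) ^ 4 * Am * Real.exp (-γ * ((R : ℝ) - 2))) := by push_cast; ring
    calc |∑ p ∈ bondBox (supNorm v + R + 1), (a ⟨p.1, p.2⟩ - lgrad (cutPot a v R) ⟨p.1, p.2⟩) * Kf p|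
        ≤ ∑ p ∈ bondBox (supNorm v + R + 1), |(a ⟨p.1, p.2⟩ - lgrad (cutPot a v R) ⟨p.1, p.2⟩) * Kf p| :=
          Finset.abs_sum_le_sum_abs _ _
      _ ≤ ∑ p ∈ bondBox (supNorm v + R + 1), (W * Real.exp (4 * γ') * Φ
              * ((∑ k : Fin 4, |((p.1 k : ℝ) - v k)|) * Real.exp (-(2 * δ) * dist y (latPt p.1)))
            + (if p.1 ∈ cubeSet v (R + 1) then 8 * R * Am * (W * Real.exp (-γ * ((R : ℝ) - 2))) else 0)) := by
          refine Finset.sum_le_sum fun p _ => ?_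
          have hA0 : 0 ≤ W * Real.exp (4 * γ') * Φ
              * ((∑ k : Fin 4, |((p.1 k : ℝ) - v k)|) * Real.exp (-(2 * δ) * dist y (latPt p.1))) :=
            mul_nonneg (by positivity) (mul_nonneg (Finset.sum_nonneg fun _ _ => abs_nonneg _) (Real.exp_pos _).le)
          have hB0 : 0 ≤ (if p.1 ∈ cubeSet v (R + 1) then 8 * R * Am * (W * Real.exp (-γ * ((R : ℝ) - 2))) else 0) := by
            split_ifs
            · positivity
            · exact le_rfl
          by_cases hg : InCube v R p.1 ∧ InCube v R (p.1 + Pi.single p.2 1)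
          · exact (hin p hg.1 hg.2).trans (le_add_of_nonneg_right hB0)
          · exact (hout p hg).trans (le_add_of_nonneg_left hA0)
      _ ≤ _ := by rw [Finset.sum_add_distrib]; exact add_le_add hsumA hsumB
  -- `R → ∞`
  have hlim : Tendsto (fun R : ℕ => W * (Real.exp (4 * γ') * C1 δ) * Φ
      + W * (32 * R * (2 * R + 3) ^ 4 * Am * Real.exp (-γ * ((R : ℝ) - 2)))) atTop
      (𝓝 (W * (Real.exp (4 * γ') * C1 δ) * Φ + 0)) := by
    refine tendsto_const_nhds.add ?_
    have h := (tendsto_tail hγ0 (32 * Am)).const_mul W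
    rw [mul_zero] at h
    refine h.congr fun R => ?_
    ring
  rw [add_zero] at hlim
  exact ge_of_tendsto hlim (Filter.eventually_atTop.2 ⟨M + supNorm v + 1, main⟩)


/-! ## §8  LEMMA A.1 AT LEVEL `0` (`L = 1`): (A.1) and (A.2)–(A.3) for the constrained minimiser of every finitely supported
bond assignment, from Estimates 0.6 and 0.7 of the unit-configuration modes of I -/

/-- The vertex of the coarse lattice (`ℤ⁴`) below `y`: «We find a vertex in the length scale L lattice … that is closest to p».
[cite: Federbush1990PhaseCellV, App. A p. 451] -/
def nearPt (y : E4) : Fin 4 → ℤ := fun j => ⌊y j⌋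

/-- It is within `2` of `y`. [cite: Federbush1990PhaseCellV, App. A p. 451] -/
theorem dist_nearPt_le (y : E4) : dist y (latPt (nearPt y)) ≤ 2 := by
  rw [EuclideanSpace.dist_eq]
  have hcoord : ∀ j : Fin 4, dist (y j) (latPt (nearPt y) j) ^ 2 ≤ 1 := by
    intro j
    have hj : (latPt (nearPt y) : E4) j = (⌊y j⌋ : ℝ) := ModeEstimatesSuperposition.src_zero_apply (nearPt y) 0 j
    rw [hj, Real.dist_eq]
    have h1 : 0 ≤ y j - ⌊y j⌋ := by linarith [Int.floor_le (y j)]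
    have h2 : y j - ⌊y j⌋ < 1 := by linarith [Int.lt_floor_add_one (y j)]
    rw [abs_of_nonneg h1]
    nlinarith
  have hsum : ∑ j : Fin 4, dist (y j) (latPt (nearPt y) j) ^ 2 ≤ 4 := by
    calc ∑ j : Fin 4, dist (y j) (latPt (nearPt y) j) ^ 2 ≤ ∑ _j : Fin 4, (1 : ℝ) := Finset.sum_le_sum fun j _ => hcoord j
      _ = 4 := by simp
  calc Real.sqrt (∑ j : Fin 4, dist (y j) (latPt (nearPt y) j) ^ 2) ≤ Real.sqrt 4 := Real.sqrt_le_sqrt hsum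
    _ = 2 := by rw [show (4 : ℝ) = 2 ^ 2 by norm_num, Real.sqrt_sq (by norm_num)]

/-- The (A.1) constant `c(γ′) = c · e^{4γ′} · C₁((γ − γ′)/2)` (`c`, `γ` from Estimate 0.6 of the unit modes).
[cite: Federbush1990PhaseCellV, (A.1) p. 451] -/
def constA1 (c γ γ' : ℝ) : ℝ := c * (Real.exp (4 * γ') * C1 ((γ - γ') / 2))

/-- `c(γ′) > 0`. [cite: Federbush1990PhaseCellV, (A.1) p. 451] -/
theorem constA1_pos {c γ γ' : ℝ} (hc : 0 < c) (hγ' : γ' < γ) : 0 < constA1 c γ γ' :=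
  mul_pos hc (mul_pos (Real.exp_pos _) (C1_pos (by linarith)))

/-- **LEMMA A.1 OF [Federbush1990PhaseCellV], LEVEL `0` (`L = ℓ₀ = 1`), (A.1) AND (A.2)–(A.3), PROVED for the concrete
Bałaban averaging.**  There are `γ > 0` (the rate of Estimates 0.6–0.7 of I), a region constant `c > 0` (that of Estimate 0.7
of I) and constants `c(γ′)`, `c_ε(γ′)` such that for every bond assignment `a` fixed on the unit lattice and supported in a box
there is a potential `A` compatible with `a` and minimising the continuum action under this constraint, whose induced plaquette
assignments at every finer level `s` (length `l = ℓ_s`) satisfy, for EVERY `γ′ ∈ (0, γ)`: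
(A.1) `|A_{∂p}| ≤ c(γ′) l² Σ_P |A_{∂P}| e^{−γ′ d(p,P)}`;
(A.2) for parallel `p₁, p₂` with (A.3) `d(p₁,p₂) < c`: `|A_{∂p₁} − A_{∂p₂}| ≤ c_ε(γ′) d(p₁,p₂)^{1−ε} l² Σ_P e^{−γ′d(p₁,P)} |A_{∂P}|`
for each `ε > 0` — the sums over the level-0 plaquettes `P` (those with base in the box one larger than the support; elsewhere
`A_{∂P} = 0`). [cite: Federbush1990PhaseCellV, Appendix A, Lemma A.1 (A.1)–(A.3) p. 451; Federbush1986PhaseCellI, Estimates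
0.6–0.7 (0.9)–(0.11) pp. 320–321, §3 p. 327] -/
theorem lemmaA1_level0 :
    ∃ γ > (0 : ℝ), ∃ c > (0 : ℝ), ∃ cA : ℝ → ℝ, ∃ cB : ℝ → ℝ → ℝ, (∀ γ', 0 < γ' → γ' < γ → 0 < cA γ') ∧
      ∀ (M : ℕ) (a : Edge 0 → ℝ), (∀ e : Edge 0, e.base ∉ box M → a e = 0) →
        ∃ A : E4 → Fin 4 → ℝ, axialTreeAveraging.IsConstrainedMinimizer 0 a A ∧
          (∀ γ', 0 < γ' → γ' < γ → ∀ (s : ℕ) (q : Plaq s),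
            |axialTreeAveraging.plaq s A q|
              ≤ cA γ' * latLen s ^ 2 * ∑ P ∈ plaqBox (M + 1), |plaqOfBonds a P| * Real.exp (-γ' * dist q.src P.src)) ∧
          (∀ γ', 0 < γ' → γ' < γ → ∀ ε > (0 : ℝ), ∀ (s : ℕ) (q₁ q₂ : Plaq s), q₁.dir₁ = q₂.dir₁ → q₁.dir₂ = q₂.dir₂ →
            dist q₁.src q₂.src < c →
              |axialTreeAveraging.plaq s A q₁ - axialTreeAveraging.plaq s A q₂|
                ≤ cB ε γ' * dist q₁.src q₂.src ^ (1 - ε) * latLen s ^ 2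
                    * ∑ P ∈ plaqBox (M + 1), |plaqOfBonds a P| * Real.exp (-γ' * dist q₁.src P.src)) := by
  obtain ⟨c, hc, γ, hγ, cε, N, hN, -, -, -, -, -, h6, h7⟩ :=
    ModeEstimatesSuperposition.unit_of_modeEstimatesLe CorrectedMode.modeEstimatesLe
  have hN1 : ∀ μ, ContDiff ℝ 1 (N μ) := fun μ => (hN μ).1
  refine ⟨γ, hγ, c, hc, fun γ' => constA1 c γ γ', fun ε γ' => constA1 |cε ε| γ γ',
    fun γ' _ hγ'γ => constA1_pos hc hγ'γ, fun M a ha => ?_⟩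
  refine ⟨superpose (bondBox M) a N, (ModeTranslation.isConstrainedMinimizer_superposition hN ha).1, ?_, ?_⟩
  · -- (A.1)
    intro γ' hγ' hγ'γ s q
    rw [plaq_superpose_eq_sum hN1]
    have hKf : ∀ p : (Fin 4 → ℤ) × Fin 4, |kernel N s q p| ≤ c * latLen s ^ 2 * Real.exp (-γ * dist q.src (latPt p.1)) := by
      intro p
      obtain ⟨n, d₁, d₂⟩ := q
      have h := h6 p.2 s (Nat.zero_le s) ⟨shiftBase s p.1 n, d₁, d₂⟩
      simp only [div_one, mul_one] at h
      rw [ModeEstimatesSuperposition.plaqSrc_shiftBase, ModeEstimatesSuperposition.dist_plaqSrc_sub_latVec_zero _ p.1 p.2] at h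
      exact h
    have hb := pairing_bound (Kf := kernel N s q) (mul_nonneg hc.le (sq_nonneg _)) hγ' hγ'γ (dist_nearPt_le q.src) hKf ha
      fun M' lam hMM' hlam => sum_kernel_gauge hN hMM' ha hlam s q
    calc |∑ p ∈ bondBox M, a ⟨p.1, p.2⟩ * kernel N s q p|
        ≤ c * latLen s ^ 2 * (Real.exp (4 * γ') * C1 ((γ - γ') / 2)) * phiSum a M γ' q.src := hb
      _ = constA1 c γ γ' * latLen s ^ 2 * ∑ P ∈ plaqBox (M + 1), |plaqOfBonds a P| * Real.exp (-γ' * dist q.src P.src) := by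
          unfold constA1 phiSum; ring
  · -- (A.2) under (A.3)
    intro γ' hγ' hγ'γ ε hε s q₁ q₂ hd₁ hd₂ hd
    rw [plaq_superpose_eq_sum hN1, plaq_superpose_eq_sum hN1, ← Finset.sum_sub_distrib]
    have hsub : ∀ p : (Fin 4 → ℤ) × Fin 4,
        a ⟨p.1, p.2⟩ * kernel N s q₁ p - a ⟨p.1, p.2⟩ * kernel N s q₂ p = a ⟨p.1, p.2⟩ * (kernel N s q₁ p - kernel N s q₂ p) :=
      fun p => by ring
    simp only [hsub]
    -- the kernel difference is localised by Estimate 0.7 of the unit modes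
    have hKf : ∀ p : (Fin 4 → ℤ) × Fin 4, |kernel N s q₁ p - kernel N s q₂ p|
        ≤ |cε ε| * dist q₁.src q₂.src ^ (1 - ε) * latLen s ^ 2 * Real.exp (-γ * dist q₁.src (latPt p.1)) := by
      intro p
      obtain ⟨n₁, d₁, d₂⟩ := q₁
      obtain ⟨n₂, d₁', d₂'⟩ := q₂
      simp only at hd₁ hd₂
      subst hd₁ hd₂
      have hpar := h7 p.2 ε hε s (Nat.zero_le s) ⟨shiftBase s p.1 n₁, d₁, d₂⟩ ⟨shiftBase s p.1 n₂, d₁, d₂⟩ rfl rfl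
      rw [ModeEstimatesSuperposition.plaqSrc_shiftBase, ModeEstimatesSuperposition.plaqSrc_shiftBase, dist_sub_right,
        ModeEstimatesSuperposition.dist_plaqSrc_sub_latVec_zero _ p.1 p.2] at hpar
      simp only [mul_one, Real.one_rpow, div_one] at hpar
      refine (hpar hd).trans ?_
      have hrest : 0 ≤ dist (⟨n₁, d₁, d₂⟩ : Plaq s).src (⟨n₂, d₁, d₂⟩ : Plaq s).src ^ (1 - ε) * latLen s ^ 2
          * Real.exp (-γ * dist (⟨n₁, d₁, d₂⟩ : Plaq s).src (latPt p.1)) := by positivity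
      calc cε ε * dist (⟨n₁, d₁, d₂⟩ : Plaq s).src (⟨n₂, d₁, d₂⟩ : Plaq s).src ^ (1 - ε) * latLen s ^ 2
            * Real.exp (-γ * dist (⟨n₁, d₁, d₂⟩ : Plaq s).src (⟨p.1, p.2⟩ : Edge 0).src)
          = cε ε * (dist (⟨n₁, d₁, d₂⟩ : Plaq s).src (⟨n₂, d₁, d₂⟩ : Plaq s).src ^ (1 - ε) * latLen s ^ 2
            * Real.exp (-γ * dist (⟨n₁, d₁, d₂⟩ : Plaq s).src (latPt p.1))) := by simp only [mul_assoc]; rfl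
        _ ≤ |cε ε| * (dist (⟨n₁, d₁, d₂⟩ : Plaq s).src (⟨n₂, d₁, d₂⟩ : Plaq s).src ^ (1 - ε) * latLen s ^ 2
            * Real.exp (-γ * dist (⟨n₁, d₁, d₂⟩ : Plaq s).src (latPt p.1))) :=
            mul_le_mul_of_nonneg_right (le_abs_self _) hrest
        _ = _ := by ring
    have hinv : ∀ (M' : ℕ) (lam : (Fin 4 → ℤ) → ℝ), M ≤ M' → (∀ x, x ∉ box M' → lam x = 0) →
        ∑ p ∈ bondBox M, a ⟨p.1, p.2⟩ * (kernel N s q₁ p - kernel N s q₂ p)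
          = ∑ p ∈ bondBox (M' + 1), (a ⟨p.1, p.2⟩ - lgrad lam ⟨p.1, p.2⟩) * (kernel N s q₁ p - kernel N s q₂ p) := by
      intro M' lam hMM' hlam
      have e1 := sum_kernel_gauge hN hMM' ha hlam s q₁
      have e2 := sum_kernel_gauge hN hMM' ha hlam s q₂
      simp only [mul_sub, Finset.sum_sub_distrib, e1, e2]
    have hW : 0 ≤ |cε ε| * dist q₁.src q₂.src ^ (1 - ε) * latLen s ^ 2 := by positivity
    have hb := pairing_bound (Kf := fun p => kernel N s q₁ p - kernel N s q₂ p) hW hγ' hγ'γ (dist_nearPt_le q₁.src) hKf ha hinv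
    calc |∑ p ∈ bondBox M, a ⟨p.1, p.2⟩ * (kernel N s q₁ p - kernel N s q₂ p)|
        ≤ |cε ε| * dist q₁.src q₂.src ^ (1 - ε) * latLen s ^ 2 * (Real.exp (4 * γ') * C1 ((γ - γ') / 2))
            * phiSum a M γ' q₁.src := hb
      _ = constA1 |cε ε| γ γ' * dist q₁.src q₂.src ^ (1 - ε) * latLen s ^ 2
            * ∑ P ∈ plaqBox (M + 1), |plaqOfBonds a P| * Real.exp (-γ' * dist q₁.src P.src) := by
          unfold constA1 phiSum; ring


/-! ## §9  LEMMA A.1 AS PRINTED: «plaquette assignments specified at length scale L, level r», `p` at length scale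
`l = ℓ_s`, `s ≥ r` — by the scaling of I §3 («By scaling arguments it is enough to study level 0 modes») -/

/-- The level-`r` plaquette with the same integer labels as the level-`0` plaquette `P` (the dilation `x ↦ ℓ_r x`).
[cite: Federbush1986PhaseCellI, §3 p. 327] -/
def atLevel (r : ℕ) (P : Plaq 0) : Plaq r := ⟨P.base, P.dir₁, P.dir₂⟩

/-- The Hölder/scaling algebra of (A.2): `(L⁻¹d)^{1−ε} (l/L)² = d^{1−ε} · l²/L^{3−ε}`. [cite: Federbush1990PhaseCellV, (A.2) p. 451] -/
theorem scale_factor {L d l : ℝ} (hL : 0 < L) (hd : 0 ≤ d) (ε : ℝ) :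
    (L⁻¹ * d) ^ (1 - ε) * (l / L) ^ 2 = d ^ (1 - ε) * (l ^ 2 / L ^ (3 - ε)) := by
  rw [Real.mul_rpow (inv_nonneg.2 hL.le) hd, Real.inv_rpow hL.le]
  have h3 : L ^ (3 - ε) = L ^ (1 - ε) * L ^ 2 := by
    rw [show (3 : ℝ) - ε = (1 - ε) + 2 by ring, Real.rpow_add hL, Real.rpow_two]
  rw [h3]
  have hpos : 0 < L ^ (1 - ε) := Real.rpow_pos_of_pos hL _
  field_simp

/-- **LEMMA A.1 OF [Federbush1990PhaseCellV] (A.1)–(A.3), AS PRINTED (data at length scale `L = ℓ_r`, level `r`; `p` at length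
scale `l = ℓ_s`, `s ≥ r`), PROVED for the concrete Bałaban averaging.**  There are `γ > 0` («γ as in I»: the rate of Estimates
0.6–0.7), the region constant `c > 0` of (A.3) (that of Estimate 0.7 of I) and, for every `γ′ < γ` («γ′ is any number,
γ′ < γ»), constants `c(γ′) > 0`, `c_ε(γ′)`, such that: for every level `r` and every bond assignment `a` fixed on `ℒ^r` and
supported in a box, there is a continuum field `A` compatible with `a` minimising the continuum action under this constraint
(«a continuum field minimizing the continuum action, for the Abelian theory, with plaquette assignments specified at length scale
L, level r»), whose plaquette assignments satisfy, for all `s ≥ r`, `p, p₁, p₂ ∈ 𝒫^s`: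
(A.1) `|A_{∂p}| ≤ c(γ′) (l/L)² Σ_{P∈𝒫^r} |A_{∂P}| e^{−γ′d(p,P)/L}`;
(A.2) `p₁ ∥ p₂`, (A.3) `d(p₁,p₂) < cL` ⇒ `|A_{∂p₁} − A_{∂p₂}| ≤ c_ε(γ′) d(p₁,p₂)^{1−ε} (l²/L^{3−ε}) Σ_{P∈𝒫^r} e^{−γ′d(p₁,P)/L}|A_{∂P}|`,
each `ε > 0`; the sums run over the level-`r` plaquettes with base in the box one larger than the support of `a` (all others have
`A_{∂P} = 0`). [cite: Federbush1990PhaseCellV, Appendix A «A Postscript to I», Lemma A.1 (A.1)–(A.3) p. 451; Federbush1986PhaseCellI,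
Estimates 0.6–0.7 pp. 320–321, §3 p. 327] -/
theorem lemmaA1 :
    ∃ γ > (0 : ℝ), ∃ c > (0 : ℝ), ∃ cA : ℝ → ℝ, ∃ cB : ℝ → ℝ → ℝ, (∀ γ', 0 < γ' → γ' < γ → 0 < cA γ') ∧
      ∀ (r M : ℕ) (a : Edge r → ℝ), (∀ e : Edge r, e.base ∉ box M → a e = 0) →
        ∃ A : E4 → Fin 4 → ℝ, axialTreeAveraging.IsConstrainedMinimizer r a A ∧
          (∀ γ', 0 < γ' → γ' < γ → ∀ s, r ≤ s → ∀ q : Plaq s,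
            |axialTreeAveraging.plaq s A q|
              ≤ cA γ' * (latLen s / latLen r) ^ 2
                  * ∑ P ∈ plaqBox (M + 1), |plaqOfBonds a (atLevel r P)|
                      * Real.exp (-γ' * dist q.src (atLevel r P).src / latLen r)) ∧
          (∀ γ', 0 < γ' → γ' < γ → ∀ ε > (0 : ℝ), ∀ s, r ≤ s → ∀ q₁ q₂ : Plaq s, q₁.dir₁ = q₂.dir₁ → q₁.dir₂ = q₂.dir₂ →
            dist q₁.src q₂.src < c * latLen r →
              |axialTreeAveraging.plaq s A q₁ - axialTreeAveraging.plaq s A q₂|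
                ≤ cB ε γ' * dist q₁.src q₂.src ^ (1 - ε) * (latLen s ^ 2 / latLen r ^ (3 - ε))
                    * ∑ P ∈ plaqBox (M + 1), |plaqOfBonds a (atLevel r P)|
                        * Real.exp (-γ' * dist q₁.src (atLevel r P).src / latLen r)) := by
  obtain ⟨γ, hγ, c, hc, cA, cB, hcA, H⟩ := lemmaA1_level0
  refine ⟨γ, hγ, c, hc, cA, cB, hcA, fun r M a ha => ?_⟩
  -- the level-0 copy of the data and its minimiser
  set a₀ : Edge 0 → ℝ := fun e => a ⟨e.base, e.dir⟩ with ha₀def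
  have ha₀ : ∀ e : Edge 0, e.base ∉ box M → a₀ e = 0 := fun e he => ha ⟨e.base, e.dir⟩ he
  obtain ⟨A₀, hA₀, h1, h2⟩ := H M a₀ ha₀
  have hℓ : 0 < latLen r := by unfold latLen; positivity
  -- plaquette variables and weights of the level-0 copy are those of the level-`r` data, rescaled
  have hF : ∀ P : Plaq 0, plaqOfBonds a₀ P = plaqOfBonds a (atLevel r P) := fun P => rfl
  have hsrcP : ∀ P : Plaq 0, P.src = (latLen r)⁻¹ • (atLevel r P).src := by
    intro P
    obtain ⟨b, d₁, d₂⟩ := P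
    rw [ModeEstimatesScaling.plaqSrc_eq_edgeSrc, atLevel, ModeEstimatesScaling.plaqSrc_eq_edgeSrc]
    exact ModeEstimatesScaling.src_zero_eq r b d₁
  have hsrcq : ∀ (k : ℕ) (b : Fin 4 → ℤ) (d₁ d₂ : Fin 4),
      (⟨b, d₁, d₂⟩ : Plaq k).src = (latLen r)⁻¹ • (⟨b, d₁, d₂⟩ : Plaq (k + r)).src := by
    intro k b d₁ d₂
    rw [ModeEstimatesScaling.plaqSrc_eq_edgeSrc, ModeEstimatesScaling.plaqSrc_eq_edgeSrc]
    exact ModeEstimatesScaling.src_level_zero_eq k r b d₁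
  have hexp : ∀ (γ' : ℝ) (x z : E4), Real.exp (-γ' * dist ((latLen r)⁻¹ • x) ((latLen r)⁻¹ • z))
      = Real.exp (-γ' * dist x z / latLen r) := by
    intro γ' x z
    rw [ModeEstimatesScaling.dist_inv_smul, div_eq_mul_inv]
    congr 1
    ring
  refine ⟨unscaleField r A₀, ?_, ?_, ?_⟩
  · rw [isConstrainedMinimizer_iff_scaleField, scaleField_unscaleField]
    exact hA₀
  · -- (A.1)
    intro γ' hγ' hγ'γ s hs q
    obtain ⟨k, rfl⟩ := Nat.exists_eq_add_of_le' hs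
    obtain ⟨b, d₁, d₂⟩ := q
    rw [ModeEstimatesScaling.plaq_unscaleField_level, ModeEstimatesScaling.latLen_add_div k r]
    refine (h1 γ' hγ' hγ'γ k ⟨b, d₁, d₂⟩).trans (le_of_eq ?_)
    congr 1
    refine Finset.sum_congr rfl fun P _ => ?_
    rw [hF, hsrcq k b d₁ d₂, hsrcP P, hexp]
  · -- (A.2) under (A.3)
    intro γ' hγ' hγ'γ ε hε s hs q₁ q₂ hd₁ hd₂ hd
    obtain ⟨k, rfl⟩ := Nat.exists_eq_add_of_le' hs
    obtain ⟨b₁, d₁, d₂⟩ := q₁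
    obtain ⟨b₂, d₁', d₂'⟩ := q₂
    simp only at hd₁ hd₂
    subst hd₁ hd₂
    rw [ModeEstimatesScaling.plaq_unscaleField_level, ModeEstimatesScaling.plaq_unscaleField_level]
    have hd0 : dist (⟨b₁, d₁, d₂⟩ : Plaq k).src (⟨b₂, d₁, d₂⟩ : Plaq k).src < c := by
      rw [hsrcq k b₁ d₁ d₂, hsrcq k b₂ d₁ d₂, ModeEstimatesScaling.dist_inv_smul, inv_mul_lt_iff₀ hℓ, mul_comm]
      exact hd
    refine (h2 γ' hγ' hγ'γ ε hε k ⟨b₁, d₁, d₂⟩ ⟨b₂, d₁, d₂⟩ rfl rfl hd0).trans (le_of_eq ?_)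
    rw [hsrcq k b₁ d₁ d₂, hsrcq k b₂ d₁ d₂, ModeEstimatesScaling.dist_inv_smul, ← ModeEstimatesScaling.latLen_add_div k r]
    have hsum : ∑ P ∈ plaqBox (M + 1), |plaqOfBonds a₀ P|
          * Real.exp (-γ' * dist ((latLen r)⁻¹ • (⟨b₁, d₁, d₂⟩ : Plaq (k + r)).src) P.src)
        = ∑ P ∈ plaqBox (M + 1), |plaqOfBonds a (atLevel r P)|
          * Real.exp (-γ' * dist (⟨b₁, d₁, d₂⟩ : Plaq (k + r)).src (atLevel r P).src / latLen r) := by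
      refine Finset.sum_congr rfl fun P _ => ?_
      rw [hF, hsrcP P, hexp]
    rw [hsum]
    set dd := dist (⟨b₁, d₁, d₂⟩ : Plaq (k + r)).src (⟨b₂, d₁, d₂⟩ : Plaq (k + r)).src with hdd
    set S := ∑ P ∈ plaqBox (M + 1), |plaqOfBonds a (atLevel r P)|
        * Real.exp (-γ' * dist (⟨b₁, d₁, d₂⟩ : Plaq (k + r)).src (atLevel r P).src / latLen r) with hS
    have key := scale_factor (l := latLen (k + r)) hℓ (dist_nonneg : 0 ≤ dd) ε
    rw [show cB ε γ' * ((latLen r)⁻¹ * dd) ^ (1 - ε) * (latLen (k + r) / latLen r) ^ 2 * S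
        = cB ε γ' * (((latLen r)⁻¹ * dd) ^ (1 - ε) * (latLen (k + r) / latLen r) ^ 2) * S by ring, key]
    ring

end PostscriptV

end

end Literature.MathematicalPhysics.QuantumFieldTheory.Federbush1986
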